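import Literature.NumberTheory.LFunctions.UnconditionalPairCorrelationExplicitFormula
import Literature.NumberTheory.LFunctions.MontgomeryZeroSideProofs
import Literature.NumberTheory.LFunctions.ZetaOrdinateDictionary
import HarnessLib

/-!
RH-FREE — «nothing here bears on the truth of RH».

# The dyadic pair sum versus the mean square of the zero side on `[T, 2T]`
# (Baluyot–Goldston–Suriajaya–Turnage-Butterbaugh, Acta Arith. 214 (2024), Lemma 4, for the
# window `T < γ ≤ 2T` of arXiv:2501.14545 §2)

Topic `Literature/NumberTheory/LFunctions` (namespace `Literature.NumberTheory.LFunctions`, paper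
objects in `BGSTB2024`). PROOF LAYER: no named facts; the `def`s are the three real majorants of the
printed proof (`windowDensity`, `truncDensity`, `farDensity`), with bodies. Third proof file for the
discharge of `Literature.NumberTheory.LFunctions.baluyotEtAl2025_montgomeryTheorem`. Status note (no
endorsement): Lemma 4 of a refereed paper; the Vinogradov–Korobov input of the source is kept OUT of
this file (it enters only in the assembly, through the parameter `θ` below).

BGST 2024, Lemma 4: "For `x ≥ 1` and `T ≥ 3`, let `L(x,T) := ∫_0^T |Σ_ρ 2x^{δ+iγ}/(1+((t−γ)+iδ)²)|² dt`.
Then `F(x,T) = L(x,T)/2π + O(x^{1−2η(T log²T)} log³T) + O(x)`", proved by truncating the sum over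
zeros with the trivial estimate (trivialestimate) `|Σ_ρ …| ≪ x^{1/2} Σ_γ 1/(1+(t−γ)²) ≪ x^{1/2} log(|t|+2)`,
then "Montgomery's argument" (exclude `γ ∉ [0,T]` inside `∫_0^T`, extend the integration to `ℝ`),
"where we need to include the factor `x^{δ+δ'} ≪ x^{2Θ(Z)−1}`", `Θ(Z)` = the largest real part of a
zero with `|γ| ≤ Z`, and finally Lemma 3. Here the same is done for the DYADIC window of the 2025
correction, with the integral over `[T, 2T]`, the truncation height `Z = T²` (instead of `T log²T`;
only bookkeeping changes) and the bound `Θ(Z) ≤ θ` kept as an explicit HYPOTHESIS on a parameter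
`θ ∈ [1/2, 1]` (the assembly feeds the tree's Vinogradov–Korobov region):

* `BGSTB2024.dyadic_zeroSide` — there is an absolute `C` such that for all `T ≥ 4`, `x ≥ 1` and
  `θ ≤ 1` with `Re ρ ≤ θ` for every non-trivial zero with `|Im ρ| ≤ T²`:
  `|∫_T^{2T} ‖S_u(x,t)‖² dt − (π/2) Re 𝓕(x,T)| ≤ C (x^{2θ−1} log³(2T+2) + x log²(2T+2)/T)`,
  where `S_u = BGSTB2024.zeroKernelSeries` (all zeros) and `(π/2) Re 𝓕(x,T) = ∫_ℝ ‖S₁‖²`,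
  `S₁ = BGSTB2024.zeroKernelSum (zerosIn T)` (Lemma 3, `integral_norm_zeroKernelSum_zerosIn_sq`).

Route (Montgomery 1973 §3 / Goldston 2005 §4 as formalised in `MontgomeryZeroSideProofs.lean`, with the
extra factor): pointwise `‖S₁‖ ≤ 4x^{θ−1/2} D_W(t)` and
`‖S_u − S₁‖ ≤ 4x^{1/2}(x^{θ−1}(A_Z − D_W) + Far_Z)` (`norm_zeroKernelSeries_sub_le`), where
`D_W = Σ_{N(T)≤n<N(2T)} 1/(1+(t−γ_n)²)`, `A_Z = Σ_{n<N(Z)} (1/(1+(t−γ_n)²) + 1/(1+(t+γ_n)²))`,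
`Far_Z` = the same sum over `n ≥ N(Z)` (dictionary zeros ↔ ordinates: `ZetaOrdinateDictionary.lean`);
the window sums are then controlled by the tree's unit-window machinery (`MontgomeryZeroWindows.lean`,
`MontgomeryZeroSideProofs.lean`: (Za)–(Zd), `N(u+1) − N(u) ≪ log u`).

## References

* [BaluyotEtAl2024] Acta Arith. 214 (2024) = arXiv:2306.04799, §2, Lemma 4 and its proof
  ((trivialestimate), (trivialestimate2), (factor)); held text `paper:arxiv-2306.04799` p0005.
* [BaluyotEtAl2025] arXiv:2501.14545, §2 (MT): the window `T < γ,γ' ≤ 2T`.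
* [Goldston2005] §4 (4.1)–(4.4); [Montgomery1973] §3 (the argument on the critical line).
-/

noncomputable section

open Complex Filter Set MeasureTheory intervalIntegral
open scoped Real Topology ComplexConjugate

namespace Literature.NumberTheory.LFunctions

namespace BGSTB2024

open Montgomery

/-! ## §1. The three real majorants (ordinate sums) -/

/-- **`D_W(t) = Σ_{N(T) ≤ n < N(2T)} 1/(1+(t−γ_n)²)`** — the Cauchy-kernel density of the zeros of
the dyadic window `T < γ ≤ 2T` (ordinates `γ_n = zetaOrdinate n` with multiplicity); the majorant of
`x^{−(θ−1/2)}|S₁(x,t)|/4`. [cite: BaluyotEtAl2024, §2 (trivialestimate)] -/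
def windowDensity (T t : ℝ) : ℝ :=
  ∑ n ∈ Finset.Ico (zetaZeroCount T) (zetaZeroCount (2 * T)), 1 / (1 + (t - zetaOrdinate n) ^ 2)

/-- **`A_Z(t) = Σ_{n<N(Z)} (1/(1+(t−γ_n)²) + 1/(1+(t+γ_n)²))`** — the density of all zeros with
`|γ| ≤ Z` (both signs). [cite: BaluyotEtAl2024, §2 (trivialestimate)] -/
def truncDensity (Z t : ℝ) : ℝ :=
  ∑ n ∈ Finset.range (zetaZeroCount Z),
    (1 / (1 + (t - zetaOrdinate n) ^ 2) + 1 / (1 + (t + zetaOrdinate n) ^ 2))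

/-- **`Far_Z(t) = Σ_{n ≥ N(Z)} (1/(1+(t−γ_n)²) + 1/(1+(t+γ_n)²))`** — the density of the zeros
with `|γ| > Z` (the truncated tail, (trivialestimate2)). [cite: BaluyotEtAl2024, §2 (trivialestimate2)] -/
def farDensity (Z t : ℝ) : ℝ :=
  ∑' n : ℕ, (1 / (1 + (t - zetaOrdinate (n + zetaZeroCount Z)) ^ 2) +
    1 / (1 + (t + zetaOrdinate (n + zetaZeroCount Z)) ^ 2))

/-- `D_W ≥ 0`. [cite: BaluyotEtAl2024, §2 (trivialestimate)] -/
theorem windowDensity_nonneg (T t : ℝ) : 0 ≤ windowDensity T t :=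
  Finset.sum_nonneg fun _ _ ↦ by positivity

/-- `Far_Z ≥ 0`. [cite: BaluyotEtAl2024, §2 (trivialestimate2)] -/
theorem farDensity_nonneg (Z t : ℝ) : 0 ≤ farDensity Z t :=
  tsum_nonneg fun _ ↦ by positivity

/-- Summability of the two-sided kernel over the ordinates. [folklore] -/
private theorem summable_twoSided (t : ℝ) :
    Summable fun n : ℕ ↦ 1 / (1 + (t - zetaOrdinate n) ^ 2) + 1 / (1 + (t + zetaOrdinate n) ^ 2) :=
  (summable_firstWeight t).add (summable_secondWeight t)

/-- `A_Z + Far_Z = Σ_n (1/(1+(t−γ_n)²) + 1/(1+(t+γ_n)²))` (all ordinates). [folklore] -/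
private theorem truncDensity_add_farDensity (Z t : ℝ) :
    truncDensity Z t + farDensity Z t =
      ∑' n : ℕ, (1 / (1 + (t - zetaOrdinate n) ^ 2) + 1 / (1 + (t + zetaOrdinate n) ^ 2)) :=
  (summable_twoSided t).sum_add_tsum_nat_add (zetaZeroCount Z)

/-! ## §2. Dictionary: sums over zeros with multiplicity = sums over ordinates -/

/-- The multiplicity weight as a complex number is the order. [folklore] -/
private theorem mult_cast_eq_order {ρ : ℂ} (hρ : ρ ∈ ZetaZeros.riemannZetaNontrivialZeros) :
    (mult ρ : ℂ) = (riemannZetaZeroOrder ρ : ℂ) := by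
  have h := mult_eq_order hρ
  exact_mod_cast h

/-- **Window dictionary**: `Σ_{ρ: T<γ≤2T} m(ρ) g(γ) = Σ_{N(T)≤n<N(2T)} g(γ_n)`.
[cite: BaluyotEtAl2024, §1 («zeros are counted with multiplicity»)] -/
theorem sum_zerosIn_mult_mul_eq (g : ℝ → ℝ) (T : ℝ) :
    ∑ ρ ∈ zerosIn T, (mult ρ : ℝ) * g ρ.im =
      ∑ n ∈ Finset.Ico (zetaZeroCount T) (zetaZeroCount (2 * T)), g (zetaOrdinate n) := by
  classical
  have h := OrdinateDictionary.sum_zetaZeroBox_mul_eq_sum_range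
    (fun u ↦ if T < u then ((g u : ℝ) : ℂ) else 0) (2 * T)
  -- left side: the filtered box
  have hL : ∑ ρ ∈ (zetaZeroBox_finite 0 (2 * T)).toFinset,
      (riemannZetaZeroOrder ρ : ℂ) * (if T < ρ.im then ((g ρ.im : ℝ) : ℂ) else 0) =
      ∑ ρ ∈ zerosIn T, (riemannZetaZeroOrder ρ : ℂ) * ((g ρ.im : ℝ) : ℂ) := by
    rw [zerosIn, zerosUpTo, Finset.sum_filter]
    refine Finset.sum_congr rfl fun ρ _ ↦ ?_
    split_ifs <;> simp
  -- right side: the filtered range is `Ico N(T) N(2T)`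
  have hR : ∑ n ∈ Finset.range (zetaZeroCount (2 * T)),
      (if T < zetaOrdinate n then ((g (zetaOrdinate n) : ℝ) : ℂ) else 0) =
      ∑ n ∈ Finset.Ico (zetaZeroCount T) (zetaZeroCount (2 * T)), ((g (zetaOrdinate n) : ℝ) : ℂ) := by
    rw [← Finset.sum_filter]
    refine Finset.sum_congr ?_ fun _ _ ↦ rfl
    have key : ∀ n : ℕ, T < zetaOrdinate n ↔ zetaZeroCount T ≤ n := fun n ↦ by
      rw [← not_le, zetaOrdinate_le_iff_lt, not_lt]
    ext n
    simp only [Finset.mem_filter, Finset.mem_range, Finset.mem_Ico, key]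
    tauto
  rw [hL, hR] at h
  have h' : ((∑ ρ ∈ zerosIn T, (mult ρ : ℝ) * g ρ.im : ℝ) : ℂ) =
      ((∑ n ∈ Finset.Ico (zetaZeroCount T) (zetaZeroCount (2 * T)), g (zetaOrdinate n) : ℝ) : ℂ) := by
    push_cast
    rw [← h]
    refine Finset.sum_congr rfl fun ρ hρ ↦ ?_
    rw [mult_cast_eq_order (mem_nontrivialZeros_of_mem_zerosIn hρ)]
  exact_mod_cast h'

/-- **Two-sided dictionary**: `Σ_{|Im ρ| ≤ Z} m(ρ) g(Im ρ) = Σ_{n<N(Z)} (g(γ_n) + g(−γ_n))`.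
[cite: BaluyotEtAl2024, §1 («zeros are counted with multiplicity»)] -/
theorem sum_weilZeroFinset_mult_mul_eq (g : ℝ → ℝ) (Z : ℝ) :
    ∑ ρ ∈ weilZeroFinset Z, (mult (ρ : ℂ) : ℝ) * g (ρ : ℂ).im =
      ∑ n ∈ Finset.range (zetaZeroCount Z), (g (zetaOrdinate n) + g (-zetaOrdinate n)) := by
  have h := OrdinateDictionary.sum_weilZeroFinset_mul_eq_sum_range (fun u ↦ ((g u : ℝ) : ℂ)) Z
  have h' : ((∑ ρ ∈ weilZeroFinset Z, (mult (ρ : ℂ) : ℝ) * g (ρ : ℂ).im : ℝ) : ℂ) =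
      ((∑ n ∈ Finset.range (zetaZeroCount Z), (g (zetaOrdinate n) + g (-zetaOrdinate n)) : ℝ) : ℂ) := by
    push_cast
    rw [← h]
    refine Finset.sum_congr rfl fun ρ _ ↦ ?_
    rw [mult_cast_eq_order ρ.2]
  exact_mod_cast h'

/-- Comparison of Cauchy kernels (the tree's `OrdinateDictionary.one_div_one_add_sq_sub_le`):
`m(ρ) g_t(Im ρ) ≤ 2(1+t²) m(ρ)/(1+γ²)`, hence summable over the zeros. [folklore] -/
private theorem summable_mult_mul_kernelR (t : ℝ) :
    Summable fun ρ : ZetaZeros.riemannZetaNontrivialZeros ↦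
      (mult (ρ : ℂ) : ℝ) * (1 / (1 + (t - (ρ : ℂ).im) ^ 2)) := by
  have hS : Summable fun ρ : ZetaZeros.riemannZetaNontrivialZeros ↦
      (riemannZetaZeroOrder (ρ : ℂ) : ℝ) / (1 + (ρ : ℂ).im ^ 2) :=
    ZetaZeroSum.summable_zeroOrder_div_one_add_sq
  refine Summable.of_nonneg_of_le (fun ρ ↦ by positivity) (fun ρ ↦ ?_) (hS.mul_left (2 * (1 + t ^ 2)))
  have h := OrdinateDictionary.one_div_one_add_sq_sub_le t (ρ : ℂ).im
  have hm : (0 : ℝ) ≤ mult (ρ : ℂ) := Nat.cast_nonneg _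
  rw [mult_eq_order ρ.2] at hm ⊢
  calc (riemannZetaZeroOrder (ρ : ℂ) : ℝ) * (1 / (1 + (t - (ρ : ℂ).im) ^ 2))
      ≤ (riemannZetaZeroOrder (ρ : ℂ) : ℝ) * (2 * (1 + t ^ 2) / (1 + (ρ : ℂ).im ^ 2)) :=
        mul_le_mul_of_nonneg_left h hm
    _ = 2 * (1 + t ^ 2) * ((riemannZetaZeroOrder (ρ : ℂ) : ℝ) / (1 + (ρ : ℂ).im ^ 2)) := by ring

/-- **Full dictionary**: `Σ_ρ m(ρ) g_t(Im ρ) = Σ_n (g_t(γ_n) + g_t(−γ_n))` for the Cauchy kernel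
`g_t(u) = 1/(1+(t−u)²)` (absolutely convergent on both sides).
[cite: BaluyotEtAl2024, §2 (trivialestimate)] -/
theorem tsum_mult_mul_kernelR_eq (t : ℝ) :
    ∑' ρ : ZetaZeros.riemannZetaNontrivialZeros, (mult (ρ : ℂ) : ℝ) * (1 / (1 + (t - (ρ : ℂ).im) ^ 2)) =
      ∑' n : ℕ, (1 / (1 + (t - zetaOrdinate n) ^ 2) + 1 / (1 + (t + zetaOrdinate n) ^ 2)) := by
  have hA : Summable fun ρ : ZetaZeros.riemannZetaNontrivialZeros ↦
      (riemannZetaZeroOrder (ρ : ℂ) : ℂ) * (((1 / (1 + (t - (ρ : ℂ).im) ^ 2) : ℝ) : ℂ)) := by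
    have h := (Complex.summable_ofReal.2 (summable_mult_mul_kernelR t))
    refine h.congr fun ρ ↦ ?_
    push_cast
    rw [mult_cast_eq_order ρ.2]
  have hB : Summable fun n : ℕ ↦ (((1 / (1 + (t - zetaOrdinate n) ^ 2) : ℝ) : ℂ)) +
      (((1 / (1 + (t - -zetaOrdinate n) ^ 2) : ℝ) : ℂ)) := by
    have h := Complex.summable_ofReal.2 (summable_twoSided t)
    refine h.congr fun n ↦ ?_
    push_cast
    ring_nf
  have h := tsum_nontrivialZeros_eq_tsum_zetaOrdinate (fun u ↦ (((1 / (1 + (t - u) ^ 2) : ℝ) : ℂ))) hA hB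
  have h' : ((∑' ρ : ZetaZeros.riemannZetaNontrivialZeros,
      (mult (ρ : ℂ) : ℝ) * (1 / (1 + (t - (ρ : ℂ).im) ^ 2)) : ℝ) : ℂ) =
      ((∑' n : ℕ, (1 / (1 + (t - zetaOrdinate n) ^ 2) + 1 / (1 + (t + zetaOrdinate n) ^ 2)) : ℝ) : ℂ) := by
    rw [Complex.ofReal_tsum, Complex.ofReal_tsum]
    have e1 : (fun ρ : ZetaZeros.riemannZetaNontrivialZeros ↦
        (((mult (ρ : ℂ) : ℝ) * (1 / (1 + (t - (ρ : ℂ).im) ^ 2)) : ℝ) : ℂ)) =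
        (fun ρ : ZetaZeros.riemannZetaNontrivialZeros ↦
          (riemannZetaZeroOrder (ρ : ℂ) : ℂ) * (((1 / (1 + (t - (ρ : ℂ).im) ^ 2) : ℝ) : ℂ))) := by
      funext ρ
      push_cast
      rw [mult_cast_eq_order ρ.2]
    have e2 : (fun n : ℕ ↦ (((1 / (1 + (t - zetaOrdinate n) ^ 2) +
        1 / (1 + (t + zetaOrdinate n) ^ 2) : ℝ)) : ℂ)) =
        (fun n ↦ (((1 / (1 + (t - zetaOrdinate n) ^ 2) : ℝ) : ℂ)) +
          (((1 / (1 + (t - -zetaOrdinate n) ^ 2) : ℝ) : ℂ))) := by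
      funext n
      push_cast
      ring_nf
    rw [e1, e2, h]
  exact_mod_cast h'

/-- The window finset inside the subtype of non-trivial zeros: `{ρ : |Im ρ| ≤ 2T, T < Im ρ}`.
[cite: BaluyotEtAl2025, §2 (calF)] -/
def windowFinset (T : ℝ) : Finset ZetaZeros.riemannZetaNontrivialZeros :=
  (weilZeroFinset (2 * T)).filter fun ρ ↦ T < (ρ : ℂ).im

/-- The window finset maps onto `zerosIn T` (`T ≥ 0`). [cite: BaluyotEtAl2025, §2 (calF)] -/
theorem windowFinset_map {T : ℝ} (hT : 0 ≤ T) :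
    (windowFinset T).map (Function.Embedding.subtype _) = zerosIn T := by
  ext z
  simp only [Finset.mem_map, Function.Embedding.subtype_apply, windowFinset, Finset.mem_filter,
    mem_weilZeroFinset, mem_zerosIn]
  constructor
  · rintro ⟨ρ, ⟨h1, h2⟩, rfl⟩
    have h0 : 0 < (ρ : ℂ).im := lt_of_le_of_lt hT h2
    refine ⟨⟨ZetaZeros.riemannZetaNontrivialZeros.zeta_eq_zero ρ.2,
      (ZetaZeros.riemannZetaNontrivialZeros.re_pos ρ.2).le,
      (ZetaZeros.riemannZetaNontrivialZeros.re_lt_one ρ.2).le, h0, ?_⟩, h2⟩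
    exact (le_abs_self _).trans h1
  · rintro ⟨⟨hζ, -, -, him, h2T⟩, hT'⟩
    refine ⟨⟨z, ZetaZeros.riemannZetaNontrivialZeros.mem_of_im_ne_zero hζ him.ne'⟩, ⟨?_, hT'⟩, rfl⟩
    simp only
    rw [abs_of_pos him]
    exact h2T

/-- Sums over the window finset are sums over `zerosIn T`. [cite: BaluyotEtAl2025, §2 (calF)] -/
theorem sum_windowFinset_eq {M : Type*} [AddCommMonoid M] (f : ℂ → M) {T : ℝ} (hT : 0 ≤ T) :
    ∑ ρ ∈ windowFinset T, f ρ = ∑ z ∈ zerosIn T, f z := by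
  rw [← windowFinset_map hT, Finset.sum_map]
  rfl

/-- The window finset lies inside `weilZeroFinset Z` for `2T ≤ Z`. [cite: BaluyotEtAl2025, §2 (calF)] -/
theorem windowFinset_subset {T Z : ℝ} (hTZ : 2 * T ≤ Z) : windowFinset T ⊆ weilZeroFinset Z := by
  intro ρ hρ
  rw [windowFinset, Finset.mem_filter, mem_weilZeroFinset] at hρ
  rw [mem_weilZeroFinset]
  exact hρ.1.trans hTZ

/-! ## §3. Pointwise majorants of the window sum and of the tail -/

/-- `‖x^{ρ−1/2}‖ ≤ x^{θ−1/2}` when `Re ρ ≤ θ` and `x ≥ 1` (the source's factor `x^δ ≤ x^{Θ−1/2}`).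
[cite: BaluyotEtAl2024, §2 (factor)] -/
theorem norm_cpow_sub_half_le_rpow {x : ℝ} (hx : 1 ≤ x) {ρ : ℂ} {θ : ℝ} (hρ : ρ.re ≤ θ) :
    ‖(x : ℂ) ^ (ρ - 1 / 2)‖ ≤ x ^ (θ - 1 / 2) := by
  rw [norm_cpow_eq_rpow_re_of_pos (one_pos.trans_le hx)]
  refine Real.rpow_le_rpow_of_exponent_le hx ?_
  simp only [sub_re, div_ofNat_re, one_re]
  linarith

/-- Termwise bound with the factor: for a non-trivial zero with `Re ρ ≤ θ`,
`‖m(ρ) x^{ρ−1/2} K(ρ−½,t)‖ ≤ 4 x^{θ−1/2} · m(ρ) g_t(γ)`. [cite: BaluyotEtAl2024, §2 (trivialestimate), (factor)] -/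
theorem norm_zeroKernelTerm_le_factor {x : ℝ} (hx : 1 ≤ x) (t : ℝ) {ρ : ℂ} {θ : ℝ}
    (hρ : ρ ∈ ZetaZeros.riemannZetaNontrivialZeros) (hθ : ρ.re ≤ θ) :
    ‖zeroKernelTerm x t ρ‖ ≤ 4 * x ^ (θ - 1 / 2) * ((mult ρ : ℝ) * (1 / (1 + (t - ρ.im) ^ 2))) := by
  have h1 := norm_cpow_sub_half_le_rpow hx hθ
  have h2 := norm_kernel_le (abs_re_sub_half_lt hρ).le t
  have him : (ρ - 1 / 2).im = ρ.im := by simp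
  rw [him] at h2
  unfold zeroKernelTerm
  rw [norm_mul, norm_mul, Complex.norm_natCast]
  have hm : (0 : ℝ) ≤ mult ρ := Nat.cast_nonneg _
  have hx' : 0 ≤ x ^ (θ - 1 / 2) := by positivity
  calc (mult ρ : ℝ) * ‖(x : ℂ) ^ (ρ - 1 / 2)‖ * ‖kernel (ρ - 1 / 2) t‖
      ≤ (mult ρ : ℝ) * x ^ (θ - 1 / 2) * (4 / (1 + (t - ρ.im) ^ 2)) :=
        mul_le_mul (mul_le_mul_of_nonneg_left h1 hm) h2 (norm_nonneg _) (by positivity)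
    _ = 4 * x ^ (θ - 1 / 2) * ((mult ρ : ℝ) * (1 / (1 + (t - ρ.im) ^ 2))) := by ring

/-- **The window sum is majorised by the window density**: if every zero of the window
`T < γ ≤ 2T` has `Re ρ ≤ θ`, then `‖S₁(x,t)‖ ≤ 4 x^{θ−1/2} D_W(t)` (`x ≥ 1`).
[cite: BaluyotEtAl2024, §2 (trivialestimate), (factor)] -/
theorem norm_zeroKernelSum_zerosIn_le {x : ℝ} (hx : 1 ≤ x) {T θ : ℝ}
    (hθ : ∀ ρ ∈ zerosIn T, ρ.re ≤ θ) (t : ℝ) :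
    ‖zeroKernelSum (zerosIn T) x t‖ ≤ 4 * x ^ (θ - 1 / 2) * windowDensity T t := by
  have e := sum_zerosIn_mult_mul_eq (fun u ↦ 1 / (1 + (t - u) ^ 2)) T
  unfold zeroKernelSum windowDensity
  rw [← e, Finset.mul_sum]
  refine (norm_sum_le _ _).trans (Finset.sum_le_sum fun ρ hρ ↦ ?_)
  exact norm_zeroKernelTerm_le_factor hx t (mem_nontrivialZeros_of_mem_zerosIn hρ) (hθ ρ hρ)

/-- **The tail of the zero side is majorised by the near and far densities**: for `x ≥ 1`,
`0 ≤ T`, `2T ≤ Z`, and `Re ρ ≤ θ` for every non-trivial zero with `|Im ρ| ≤ Z`,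
`‖S_u(x,t) − S₁(x,t)‖ ≤ 4x^{1/2} (x^{θ−1} (A_Z(t) − D_W(t)) + Far_Z(t))` — the zeros off the window with
`|γ| ≤ Z` carry the factor `x^{θ−1/2}`, those with `|γ| > Z` the trivial `x^{1/2}`.
[cite: BaluyotEtAl2024, Lemma 4 (proof: (trivialestimate), (trivialestimate2), (factor))] -/
theorem norm_zeroKernelSeries_sub_le {x : ℝ} (hx : 1 ≤ x) {T Z θ : ℝ} (hT : 0 ≤ T)
    (hTZ : 2 * T ≤ Z)
    (hθ : ∀ ρ ∈ ZetaZeros.riemannZetaNontrivialZeros, |ρ.im| ≤ Z → ρ.re ≤ θ) (t : ℝ) :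
    ‖zeroKernelSeries x t - zeroKernelSum (zerosIn T) x t‖ ≤
      4 * x ^ (1 / 2 : ℝ) * (x ^ (θ - 1) * (truncDensity Z t - windowDensity T t) + farDensity Z t) := by
  classical
  have hx0 : 0 < x := one_pos.trans_le hx
  set F := windowFinset T with hF
  set FZ := weilZeroFinset Z with hFZ
  set μ : ℝ := x ^ (θ - 1) with hμ
  have hμ0 : 0 ≤ μ := by positivity
  -- the real kernel density with multiplicity and its majorant
  set g : ZetaZeros.riemannZetaNontrivialZeros → ℝ :=
    fun ρ ↦ (mult (ρ : ℂ) : ℝ) * (1 / (1 + (t - (ρ : ℂ).im) ^ 2)) with hg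
  set c : ZetaZeros.riemannZetaNontrivialZeros → ℝ := fun ρ ↦ if |(ρ : ℂ).im| ≤ Z then μ else 1 with hc
  set M : ZetaZeros.riemannZetaNontrivialZeros → ℝ := fun ρ ↦ 4 * x ^ (1 / 2 : ℝ) * (c ρ * g ρ) with hM
  have hg0 : ∀ ρ, 0 ≤ g ρ := fun ρ ↦ by positivity
  have hc0 : ∀ ρ, 0 ≤ c ρ := fun ρ ↦ by simp only [hc]; split_ifs <;> positivity
  have hc1 : ∀ ρ, c ρ ≤ μ + 1 := fun ρ ↦ by
    simp only [hc]; split_ifs <;> linarith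
  have hgs : Summable g := summable_mult_mul_kernelR t
  have hMs : Summable M := by
    refine Summable.of_nonneg_of_le (fun ρ ↦ by positivity) (fun ρ ↦ ?_)
      ((hgs.mul_left (μ + 1)).mul_left (4 * x ^ (1 / 2 : ℝ)))
    exact mul_le_mul_of_nonneg_left (mul_le_mul_of_nonneg_right (hc1 ρ) (hg0 ρ)) (by positivity)
  -- termwise: `‖term ρ‖ ≤ M ρ`
  have hterm : ∀ ρ : ZetaZeros.riemannZetaNontrivialZeros, ‖zeroKernelTerm x t ρ‖ ≤ M ρ := by
    intro ρ
    simp only [hM, hc]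
    split_ifs with hle
    · have h := norm_zeroKernelTerm_le_factor hx t ρ.2 (hθ ρ ρ.2 hle)
      have e : x ^ (θ - 1 / 2) = x ^ (1 / 2 : ℝ) * μ := by
        rw [hμ, ← Real.rpow_add hx0]; congr 1; ring
      rw [e] at h
      calc ‖zeroKernelTerm x t ρ‖ ≤ 4 * (x ^ (1 / 2 : ℝ) * μ) * g ρ := h
        _ = 4 * x ^ (1 / 2 : ℝ) * (μ * g ρ) := by ring
    · have h := norm_zeroKernelTerm_le_factor hx t ρ.2
        (ZetaZeros.riemannZetaNontrivialZeros.re_lt_one ρ.2).le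
      have e : x ^ ((1 : ℝ) - 1 / 2) = x ^ (1 / 2 : ℝ) := by norm_num
      rw [e] at h
      simpa [hg] using h
  -- the splitting `S − S₁ = Σ'_{ρ ∉ F} term`
  have hsum := summable_zeroKernelTerm hx t
  have hS₁ : ∑ ρ ∈ F, zeroKernelTerm x t ρ = zeroKernelSum (zerosIn T) x t := by
    rw [hF, sum_windowFinset_eq (zeroKernelTerm x t) hT]
    rfl
  have hsplit : zeroKernelSeries x t - zeroKernelSum (zerosIn T) x t =
      ∑' ρ : {ρ // ρ ∉ F}, zeroKernelTerm x t ρ := by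
    rw [← hS₁, zeroKernelSeries, ← hsum.sum_add_tsum_subtype_compl F]
    ring
  -- norm of the tail
  have hns : Summable fun ρ : {ρ // ρ ∉ F} ↦ ‖zeroKernelTerm x t ρ‖ :=
    (summable_norm_zeroKernelTerm hx t).subtype _
  have hMs' : Summable fun ρ : {ρ // ρ ∉ F} ↦ M ρ := hMs.subtype _
  have h1 : ‖zeroKernelSeries x t - zeroKernelSum (zerosIn T) x t‖ ≤ ∑' ρ : {ρ // ρ ∉ F}, M ρ := by
    rw [hsplit]
    exact (norm_tsum_le_tsum_norm hns).trans (hns.tsum_le_tsum (fun ρ ↦ hterm ρ) hMs')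
  -- `Σ'_{∉F} M = Σ' M − Σ_F M`
  have h2 : ∑' ρ : {ρ // ρ ∉ F}, M ρ = ∑' ρ, M ρ - ∑ ρ ∈ F, M ρ := by
    rw [← hMs.sum_add_tsum_subtype_compl F]; ring
  -- `Σ' M = 4x^{1/2}(μ A + (Tot − A))`, `A = Σ_{F_Z} g`, `Tot = Σ' g`
  have h3 : ∑' ρ, M ρ = 4 * x ^ (1 / 2 : ℝ) * (μ * ∑ ρ ∈ FZ, g ρ + (∑' ρ, g ρ - ∑ ρ ∈ FZ, g ρ)) := by
    have hA : ∑ ρ ∈ FZ, M ρ = 4 * x ^ (1 / 2 : ℝ) * (μ * ∑ ρ ∈ FZ, g ρ) := by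
      rw [Finset.mul_sum, Finset.mul_sum]
      refine Finset.sum_congr rfl fun ρ hρ ↦ ?_
      have : |(ρ : ℂ).im| ≤ Z := mem_weilZeroFinset.1 hρ
      simp only [hM, hc, if_pos this]
    have hB : ∑' ρ : {ρ // ρ ∉ FZ}, M ρ = 4 * x ^ (1 / 2 : ℝ) * ∑' ρ : {ρ // ρ ∉ FZ}, g ρ := by
      rw [← tsum_mul_left]
      refine tsum_congr fun ρ ↦ ?_
      have : ¬ |((ρ : ZetaZeros.riemannZetaNontrivialZeros) : ℂ).im| ≤ Z :=
        fun h ↦ ρ.2 (mem_weilZeroFinset.2 h)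
      simp only [hM, hc, if_neg this]
      ring
    have hC : ∑' ρ : {ρ // ρ ∉ FZ}, g ρ = ∑' ρ, g ρ - ∑ ρ ∈ FZ, g ρ := by
      rw [← hgs.sum_add_tsum_subtype_compl FZ]; ring
    rw [← hMs.sum_add_tsum_subtype_compl FZ, hA, hB, hC]
    ring
  -- `Σ_F M = 4x^{1/2} μ D_W`
  have h4 : ∑ ρ ∈ F, M ρ = 4 * x ^ (1 / 2 : ℝ) * (μ * windowDensity T t) := by
    have hFμ : ∀ ρ ∈ F, M ρ = 4 * x ^ (1 / 2 : ℝ) * (μ * g ρ) := by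
      intro ρ hρ
      have : |(ρ : ℂ).im| ≤ Z := mem_weilZeroFinset.1 (windowFinset_subset hTZ hρ)
      simp only [hM, hc, if_pos this]
    rw [Finset.sum_congr rfl hFμ, ← Finset.mul_sum, ← Finset.mul_sum]
    congr 2
    have e := sum_zerosIn_mult_mul_eq (fun u ↦ 1 / (1 + (t - u) ^ 2)) T
    rw [windowDensity, ← e, hF, sum_windowFinset_eq (fun z ↦ (mult z : ℝ) * (1 / (1 + (t - z.im) ^ 2))) hT]
  -- dictionaries for `A` and `Tot`
  have h5 : ∑ ρ ∈ FZ, g ρ = truncDensity Z t := by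
    have e := sum_weilZeroFinset_mult_mul_eq (fun u ↦ 1 / (1 + (t - u) ^ 2)) Z
    simp only [sub_neg_eq_add] at e
    simp only [hg, hFZ]
    rw [e, truncDensity]
  have h6 : ∑' ρ, g ρ = truncDensity Z t + farDensity Z t := by
    rw [truncDensity_add_farDensity]
    simp only [hg]
    exact tsum_mult_mul_kernelR_eq t
  -- assemble
  calc ‖zeroKernelSeries x t - zeroKernelSum (zerosIn T) x t‖
      ≤ ∑' ρ : {ρ // ρ ∉ F}, M ρ := h1
    _ = 4 * x ^ (1 / 2 : ℝ) * (μ * (truncDensity Z t - windowDensity T t) + farDensity Z t) := by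
        rw [h2, h3, h4, h5, h6]; ring

/-- The near density is at most the truncated density: `A_Z − D_W ≤ A_Z` and `D_W ≤ A_Z`
(`D_W` is a sub-sum of the positive-ordinate half of `A_Z` when `2T ≤ Z`). [cite: BaluyotEtAl2024, §2 (trivialestimate)] -/
theorem windowDensity_le_truncDensity {T Z : ℝ} (hTZ : 2 * T ≤ Z) (t : ℝ) :
    windowDensity T t ≤ truncDensity Z t := by
  unfold windowDensity truncDensity
  have hsub : Finset.Ico (zetaZeroCount T) (zetaZeroCount (2 * T)) ⊆ Finset.range (zetaZeroCount Z) := by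
    intro n hn
    rw [Finset.mem_Ico] at hn
    exact Finset.mem_range.2 (lt_of_lt_of_le hn.2 (zetaZeroCount_mono hTZ))
  calc ∑ n ∈ Finset.Ico (zetaZeroCount T) (zetaZeroCount (2 * T)), 1 / (1 + (t - zetaOrdinate n) ^ 2)
      ≤ ∑ n ∈ Finset.range (zetaZeroCount Z), 1 / (1 + (t - zetaOrdinate n) ^ 2) :=
        Finset.sum_le_sum_of_subset_of_nonneg hsub fun n _ _ ↦ by positivity
    _ ≤ ∑ n ∈ Finset.range (zetaZeroCount Z),
        (1 / (1 + (t - zetaOrdinate n) ^ 2) + 1 / (1 + (t + zetaOrdinate n) ^ 2)) :=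
        Finset.sum_le_sum fun n _ ↦ by
          have : (0 : ℝ) ≤ 1 / (1 + (t + zetaOrdinate n) ^ 2) := by positivity
          linarith

/-! ## §4. Sup bounds for the densities (unit-window counting, `MontgomeryZeroWindows.lean`) -/

/-- `D_W(t) ≤ Σ_{n<N(2T)} 1/(1+(t−γ_n)²)`. [cite: BaluyotEtAl2024, §2 (trivialestimate)] -/
theorem windowDensity_le_sum_range (T t : ℝ) :
    windowDensity T t ≤ ∑ n ∈ Finset.range (zetaZeroCount (2 * T)), 1 / (1 + (t - zetaOrdinate n) ^ 2) := by
  unfold windowDensity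
  refine Finset.sum_le_sum_of_subset_of_nonneg (fun n hn ↦ ?_) fun n _ _ ↦ by positivity
  rw [Finset.mem_Ico] at hn
  exact Finset.mem_range.2 hn.2

/-- **Sup bound on the window** (`0 ≤ t ≤ 2T`): `D_W(t) ≤ 24 C₀ log(2T+2)`.
[cite: BaluyotEtAl2024, §2 (trivialestimate: «≪ log(|t|+2)»)] -/
theorem windowDensity_le_of_mem_Icc {C₀ : ℝ} (hC₀ : 0 ≤ C₀)
    (hW : ∀ u : ℝ, (zetaZeroCount (u + 1) : ℝ) - zetaZeroCount u ≤ C₀ * Real.log (|u| + 2))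
    {T t : ℝ} (ht : 0 ≤ t) (htT : t ≤ 2 * T) :
    windowDensity T t ≤ 24 * C₀ * Real.log (2 * T + 2) :=
  (windowDensity_le_sum_range T t).trans (sum_range_kernel_le_of_mem_Icc hC₀ hW ht htT)

/-- **Sup bound above the window** (`t ≥ 2T ≥ 0`): `D_W(t) ≤ 8C₀ log(2T+2)/(t − 2T + 1)`.
[cite: BaluyotEtAl2024, §2 (trivialestimate)] -/
theorem windowDensity_le_of_le {C₀ : ℝ} (hC₀ : 0 ≤ C₀)
    (hW : ∀ u : ℝ, (zetaZeroCount (u + 1) : ℝ) - zetaZeroCount u ≤ C₀ * Real.log (|u| + 2))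
    {T t : ℝ} (hT : 0 ≤ T) (hTt : 2 * T ≤ t) :
    windowDensity T t ≤ 8 * C₀ * Real.log (2 * T + 2) / (t - 2 * T + 1) :=
  (windowDensity_le_sum_range T t).trans (sum_range_kernel_le_of_le hC₀ hW (by linarith) hTt)

/-- **Sup bound on the negative axis** (`t ≤ 0`): `D_W(t) ≤ 16 C₀` (`log(u+2) ≤ u+1`).
[cite: BaluyotEtAl2024, §2 (trivialestimate)] -/
theorem windowDensity_le_of_nonpos {C₀ : ℝ} (hC₀ : 0 ≤ C₀)
    (hW : ∀ u : ℝ, (zetaZeroCount (u + 1) : ℝ) - zetaZeroCount u ≤ C₀ * Real.log (|u| + 2))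
    {T t : ℝ} (ht : t ≤ 0) : windowDensity T t ≤ 16 * C₀ := by
  have h := (windowDensity_le_sum_range T t).trans (sum_range_kernel_le_of_nonpos hC₀ hW ht (2 * T))
  refine h.trans ?_
  have hlog : Real.log (|t| + 2) ≤ |t| + 1 := by
    have := Real.log_le_sub_one_of_pos (show 0 < |t| + 2 by positivity)
    linarith
  rw [mul_div_assoc]
  refine mul_le_of_le_one_right (by positivity) ?_
  rw [div_le_one (by positivity)]
  exact hlog

/-- **Sup bound for the near density** (`0 ≤ t ≤ Z`): `A_Z(t) ≤ 40 C₀ log(Z+2)`.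
[cite: BaluyotEtAl2024, §2 (trivialestimate)] -/
theorem truncDensity_le {C₀ : ℝ} (hC₀ : 0 ≤ C₀)
    (hW : ∀ u : ℝ, (zetaZeroCount (u + 1) : ℝ) - zetaZeroCount u ≤ C₀ * Real.log (|u| + 2))
    {Z t : ℝ} (ht : 0 ≤ t) (htZ : t ≤ Z) :
    truncDensity Z t ≤ 40 * C₀ * Real.log (Z + 2) := by
  unfold truncDensity
  rw [Finset.sum_add_distrib]
  have h1 := sum_range_kernel_le_of_mem_Icc hC₀ hW ht htZ
  have h2 : ∑ n ∈ Finset.range (zetaZeroCount Z), 1 / (1 + (t + zetaOrdinate n) ^ 2) ≤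
      16 * C₀ * Real.log (Z + 2) := by
    refine ((summable_secondWeight t).sum_le_tsum _ fun n _ ↦ by positivity).trans ?_
    refine (tsum_kernel_neg_le hC₀ hW ht htZ).trans ?_
    have hlog : 0 ≤ Real.log (Z + 2) := Real.log_nonneg (by linarith)
    exact div_le_self (by positivity) (by linarith)
  linarith

/-- **Sup bound for the far density** (`0 ≤ t ≤ Z`): `Far_Z(t) ≤ 32 C₀ log(Z+2)/(Z − t + 1)`
(`1/(1+(t+γ)²) ≤ 1/(1+(t−γ)²)` for `t, γ ≥ 0`). [cite: BaluyotEtAl2024, §2 (trivialestimate2)] -/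
theorem farDensity_le {C₀ : ℝ} (hC₀ : 0 ≤ C₀)
    (hW : ∀ u : ℝ, (zetaZeroCount (u + 1) : ℝ) - zetaZeroCount u ≤ C₀ * Real.log (|u| + 2))
    {Z t : ℝ} (ht : 0 ≤ t) (htZ : t ≤ Z) :
    farDensity Z t ≤ 32 * C₀ * Real.log (Z + 2) / (Z - t + 1) := by
  have hs1 : Summable fun n : ℕ ↦ 1 / (1 + (t - zetaOrdinate (n + zetaZeroCount Z)) ^ 2) :=
    (summable_nat_add_iff (f := fun n ↦ 1 / (1 + (t - zetaOrdinate n) ^ 2)) (zetaZeroCount Z)).2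
      (summable_firstWeight t)
  have hs2 : Summable fun n : ℕ ↦ 1 / (1 + (t + zetaOrdinate (n + zetaZeroCount Z)) ^ 2) :=
    (summable_nat_add_iff (f := fun n ↦ 1 / (1 + (t + zetaOrdinate n) ^ 2)) (zetaZeroCount Z)).2
      (summable_secondWeight t)
  have hle : ∀ n : ℕ, 1 / (1 + (t + zetaOrdinate (n + zetaZeroCount Z)) ^ 2) ≤
      1 / (1 + (t - zetaOrdinate (n + zetaZeroCount Z)) ^ 2) := by
    intro n
    have hγ : 0 < zetaOrdinate (n + zetaZeroCount Z) := zetaOrdinate_pos_holds _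
    apply one_div_le_one_div_of_le (by positivity)
    nlinarith
  have h := tsum_kernel_shift_le hC₀ hW ht htZ
  unfold farDensity
  rw [hs1.tsum_add hs2]
  have h2 : ∑' n : ℕ, 1 / (1 + (t + zetaOrdinate (n + zetaZeroCount Z)) ^ 2) ≤
      ∑' n : ℕ, 1 / (1 + (t - zetaOrdinate (n + zetaZeroCount Z)) ^ 2) :=
    hs2.tsum_le_tsum hle hs1
  calc ∑' n : ℕ, 1 / (1 + (t - zetaOrdinate (n + zetaZeroCount Z)) ^ 2) +
        ∑' n : ℕ, 1 / (1 + (t + zetaOrdinate (n + zetaZeroCount Z)) ^ 2)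
      ≤ 2 * (16 * C₀ * Real.log (Z + 2) / (Z - t + 1)) := by linarith
    _ = 32 * C₀ * Real.log (Z + 2) / (Z - t + 1) := by ring

/-! ## §5. `L¹` bounds over the window and its complement ((Za)–(Zd)) -/

/-- `∫_a^b dt/(1+(t−c)²) = arctan(b−c) − arctan(a−c)`. [folklore] -/
private theorem integral_kernelR (a b c : ℝ) :
    ∫ t in a..b, 1 / (1 + (t - c) ^ 2) = Real.arctan (b - c) - Real.arctan (a - c) :=
  integral_eq_sub_of_hasDerivAt (fun t _ ↦ hasDerivAt_arctan_sub c t)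
    ((continuous_const.div (by fun_prop) fun t ↦ by positivity).intervalIntegrable _ _)

/-- `D_W` is continuous. [cite: BaluyotEtAl2024, §2 (trivialestimate)] -/
theorem continuous_windowDensity (T : ℝ) : Continuous fun t : ℝ ↦ windowDensity T t := by
  unfold windowDensity
  exact continuous_finsetSum _ fun n _ ↦ continuous_const.div (by fun_prop) fun t ↦ by positivity

/-- `A_Z` is continuous. [cite: BaluyotEtAl2024, §2 (trivialestimate)] -/
theorem continuous_truncDensity (Z : ℝ) : Continuous fun t : ℝ ↦ truncDensity Z t := by
  unfold truncDensity
  refine continuous_finsetSum _ fun n _ ↦ Continuous.add ?_ ?_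
  · exact continuous_const.div (by fun_prop) fun t ↦ by positivity
  · exact continuous_const.div (by fun_prop) fun t ↦ by positivity

/-- `D_W` is integrable on `ℝ`. [cite: BaluyotEtAl2024, §2 (trivialestimate)] -/
theorem integrable_windowDensity (T : ℝ) : Integrable fun t : ℝ ↦ windowDensity T t := by
  unfold windowDensity
  exact integrable_finsetSum _ fun n _ ↦ integrable_firstWeight (zetaOrdinate n)

/-- Window ordinates lie in `(T, 2T]`. [folklore] -/
private theorem mem_window_ordinate {T : ℝ} {n : ℕ}
    (hn : n ∈ Finset.Ico (zetaZeroCount T) (zetaZeroCount (2 * T))) :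
    T < zetaOrdinate n ∧ zetaOrdinate n ≤ 2 * T := by
  rw [Finset.mem_Ico] at hn
  exact ⟨not_le.1 fun h ↦ absurd (zetaOrdinate_le_iff_lt.1 h) (not_lt.2 hn.1),
    zetaOrdinate_le_iff_lt.2 hn.2⟩

/-- **`∫_{2T}^∞ D_W ≪ log²(2T+2)`** ((Zc) at height `2T`). [cite: Goldston2005, (4.3)] -/
theorem integral_Ioi_windowDensity_le {B : ℝ}
    (hB : ∀ T : ℝ, 2 ≤ T → ∀ s : Finset ℕ, (∀ n ∈ s, zetaOrdinate n ≤ T) →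
      ∑ n ∈ s, (π / 2 - Real.arctan (T - zetaOrdinate n)) ≤ B * Real.log (T + 2) ^ 2)
    {T : ℝ} (hT : 1 ≤ T) :
    ∫ t in Ioi (2 * T), windowDensity T t ≤ B * Real.log (2 * T + 2) ^ 2 := by
  unfold windowDensity
  rw [integral_finsetSum _ fun n _ ↦ (integrable_firstWeight (zetaOrdinate n)).integrableOn]
  simp_rw [integral_Ioi_firstWeight]
  exact hB (2 * T) (by linarith) _ fun n hn ↦ (mem_window_ordinate hn).2

/-- **`∫_{−∞}^0 D_W ≪ log²(2T+2)`** ((Zd) at height `2T`). [cite: Goldston2005, (4.3)] -/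
theorem integral_Iic_windowDensity_le {B : ℝ}
    (hB : ∀ T : ℝ, 2 ≤ T → ∀ s : Finset ℕ, (∀ n ∈ s, zetaOrdinate n ≤ T) →
      ∑ n ∈ s, (π / 2 - Real.arctan (zetaOrdinate n)) ≤ B * Real.log (T + 2) ^ 2)
    {T : ℝ} (hT : 1 ≤ T) :
    ∫ t in Iic (0 : ℝ), windowDensity T t ≤ B * Real.log (2 * T + 2) ^ 2 := by
  unfold windowDensity
  rw [integral_finsetSum _ fun n _ ↦ (integrable_firstWeight (zetaOrdinate n)).integrableOn]
  simp_rw [integral_Iic_firstWeight]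
  exact hB (2 * T) (by linarith) _ fun n hn ↦ (mem_window_ordinate hn).2

/-- **`∫_0^T D_W ≪ log²(T+2)`** ((Za) at height `T`: the window zeros lie above `T`).
[cite: Goldston2005, (4.3)] -/
theorem integral_zero_T_windowDensity_le {B : ℝ}
    (hB : ∀ T : ℝ, 2 ≤ T → ∀ s : Finset ℕ, (∀ n ∈ s, T < zetaOrdinate n) →
      ∑ n ∈ s, (Real.arctan (zetaOrdinate n) - Real.arctan (zetaOrdinate n - T)) ≤
        B * Real.log (T + 2) ^ 2)
    {T : ℝ} (hT : 2 ≤ T) :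
    ∫ t in (0 : ℝ)..T, windowDensity T t ≤ B * Real.log (T + 2) ^ 2 := by
  unfold windowDensity
  rw [intervalIntegral.integral_finsetSum fun n _ ↦
    (integrable_firstWeight (zetaOrdinate n)).intervalIntegrable]
  simp_rw [integral_kernelR]
  refine le_trans (le_of_eq ?_) (hB T hT _ fun n hn ↦ (mem_window_ordinate hn).1)
  refine Finset.sum_congr rfl fun n _ ↦ ?_
  rw [zero_sub, Real.arctan_neg, show T - zetaOrdinate n = -(zetaOrdinate n - T) by ring,
    Real.arctan_neg]
  ring

/-- **`∫_T^{2T} (A_Z − D_W) ≪ log²(2T+2)`** for `2T ≤ Z`: the zeros below the window contribute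
`Σ_{γ≤T}(π/2 − arctan(T−γ))` ((Zc)), those above `Σ_{γ>2T}(arctan γ − arctan(γ−2T))` ((Za) at `2T`),
and the negative ordinates `Σ_γ (arctan(2T+γ) − arctan γ)` ((Zb) at `2T`).
[cite: Goldston2005, (4.3)] -/
theorem integral_near_le {Ba Bb Bc : ℝ}
    (hBa : ∀ T : ℝ, 2 ≤ T → ∀ s : Finset ℕ, (∀ n ∈ s, T < zetaOrdinate n) →
      ∑ n ∈ s, (Real.arctan (zetaOrdinate n) - Real.arctan (zetaOrdinate n - T)) ≤
        Ba * Real.log (T + 2) ^ 2)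
    (hBb : ∀ T : ℝ, 2 ≤ T → ∀ s : Finset ℕ,
      ∑ n ∈ s, (Real.arctan (T + zetaOrdinate n) - Real.arctan (zetaOrdinate n)) ≤
        Bb * Real.log (T + 2) ^ 2)
    (hBc : ∀ T : ℝ, 2 ≤ T → ∀ s : Finset ℕ, (∀ n ∈ s, zetaOrdinate n ≤ T) →
      ∑ n ∈ s, (π / 2 - Real.arctan (T - zetaOrdinate n)) ≤ Bc * Real.log (T + 2) ^ 2)
    {T Z : ℝ} (hT : 2 ≤ T) (hTZ : 2 * T ≤ Z) :
    ∫ t in T..(2 * T), (truncDensity Z t - windowDensity T t) ≤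
      (Ba + Bb + Bc) * Real.log (2 * T + 2) ^ 2 := by
  have hT0 : 0 ≤ T := by linarith
  have hNN : zetaZeroCount T ≤ zetaZeroCount (2 * T) := zetaZeroCount_mono (by linarith)
  have hN2 : zetaZeroCount (2 * T) ≤ zetaZeroCount Z := zetaZeroCount_mono hTZ
  set g : ℕ → ℝ → ℝ := fun n t ↦ 1 / (1 + (t - zetaOrdinate n) ^ 2) with hg
  set g' : ℕ → ℝ → ℝ := fun n t ↦ 1 / (1 + (t + zetaOrdinate n) ^ 2) with hg'
  have hgc : ∀ n : ℕ, Continuous (g n) := fun n ↦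
    continuous_const.div (by fun_prop) fun t ↦ by positivity
  have hg'c : ∀ n : ℕ, Continuous (g' n) := fun n ↦
    continuous_const.div (by fun_prop) fun t ↦ by positivity
  -- split the near density into the three families of zeros
  have hsplit : ∀ t : ℝ, truncDensity Z t - windowDensity T t =
      ∑ n ∈ Finset.range (zetaZeroCount T), g n t +
        ∑ n ∈ Finset.Ico (zetaZeroCount (2 * T)) (zetaZeroCount Z), g n t +
        ∑ n ∈ Finset.range (zetaZeroCount Z), g' n t := by
    intro t
    unfold truncDensity windowDensity
    rw [Finset.sum_add_distrib]
    have h3 : ∑ n ∈ Finset.range (zetaZeroCount Z), g n t =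
        ∑ n ∈ Finset.range (zetaZeroCount T), g n t +
          ∑ n ∈ Finset.Ico (zetaZeroCount T) (zetaZeroCount (2 * T)), g n t +
          ∑ n ∈ Finset.Ico (zetaZeroCount (2 * T)) (zetaZeroCount Z), g n t := by
      rw [Finset.range_eq_Ico, Finset.range_eq_Ico, Finset.sum_Ico_consecutive _ (Nat.zero_le _) hNN,
        Finset.sum_Ico_consecutive _ (Nat.zero_le _) hN2]
    simp only [hg, hg'] at h3 ⊢
    rw [h3]
    ring
  -- interval integrability of the three families
  have hS1 : IntervalIntegrable (fun t ↦ ∑ n ∈ Finset.range (zetaZeroCount T), g n t) volume T (2 * T) :=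
    (continuous_finsetSum _ fun n _ ↦ hgc n).intervalIntegrable _ _
  have hS2 : IntervalIntegrable
      (fun t ↦ ∑ n ∈ Finset.Ico (zetaZeroCount (2 * T)) (zetaZeroCount Z), g n t) volume T (2 * T) :=
    (continuous_finsetSum _ fun n _ ↦ hgc n).intervalIntegrable _ _
  have hS3 : IntervalIntegrable (fun t ↦ ∑ n ∈ Finset.range (zetaZeroCount Z), g' n t) volume T (2 * T) :=
    (continuous_finsetSum _ fun n _ ↦ hg'c n).intervalIntegrable _ _
  have hI1 : ∫ t in T..(2 * T), ∑ n ∈ Finset.range (zetaZeroCount T), g n t =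
      ∑ n ∈ Finset.range (zetaZeroCount T),
        (Real.arctan (2 * T - zetaOrdinate n) - Real.arctan (T - zetaOrdinate n)) := by
    rw [intervalIntegral.integral_finsetSum fun n _ ↦ (hgc n).intervalIntegrable _ _]
    exact Finset.sum_congr rfl fun n _ ↦ integral_kernelR _ _ _
  have hI2 : ∫ t in T..(2 * T), ∑ n ∈ Finset.Ico (zetaZeroCount (2 * T)) (zetaZeroCount Z), g n t =
      ∑ n ∈ Finset.Ico (zetaZeroCount (2 * T)) (zetaZeroCount Z),
        (Real.arctan (2 * T - zetaOrdinate n) - Real.arctan (T - zetaOrdinate n)) := by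
    rw [intervalIntegral.integral_finsetSum fun n _ ↦ (hgc n).intervalIntegrable _ _]
    exact Finset.sum_congr rfl fun n _ ↦ integral_kernelR _ _ _
  have hI3 : ∫ t in T..(2 * T), ∑ n ∈ Finset.range (zetaZeroCount Z), g' n t =
      ∑ n ∈ Finset.range (zetaZeroCount Z),
        (Real.arctan (2 * T + zetaOrdinate n) - Real.arctan (T + zetaOrdinate n)) := by
    rw [intervalIntegral.integral_finsetSum fun n _ ↦ (hg'c n).intervalIntegrable _ _]
    refine Finset.sum_congr rfl fun n _ ↦ ?_
    have := integral_kernelR T (2 * T) (-zetaOrdinate n)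
    simp only [sub_neg_eq_add] at this
    simpa [hg'] using this
  -- bounds for the three families
  have hB1 : ∑ n ∈ Finset.range (zetaZeroCount T),
      (Real.arctan (2 * T - zetaOrdinate n) - Real.arctan (T - zetaOrdinate n)) ≤
      Bc * Real.log (T + 2) ^ 2 := by
    refine le_trans (Finset.sum_le_sum fun n _ ↦ ?_)
      (hBc T hT _ fun n hn ↦ zetaOrdinate_le_iff_lt.2 (Finset.mem_range.1 hn))
    linarith [Real.arctan_lt_pi_div_two (2 * T - zetaOrdinate n)]
  have hB2 : ∑ n ∈ Finset.Ico (zetaZeroCount (2 * T)) (zetaZeroCount Z),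
      (Real.arctan (2 * T - zetaOrdinate n) - Real.arctan (T - zetaOrdinate n)) ≤
      Ba * Real.log (2 * T + 2) ^ 2 := by
    have hmem : ∀ n ∈ Finset.Ico (zetaZeroCount (2 * T)) (zetaZeroCount Z), 2 * T < zetaOrdinate n := by
      intro n hn
      rw [Finset.mem_Ico] at hn
      exact not_le.1 fun h ↦ absurd (zetaOrdinate_le_iff_lt.1 h) (not_lt.2 hn.1)
    refine le_trans (Finset.sum_le_sum fun n hn ↦ ?_) (hBa (2 * T) (by linarith) _ hmem)
    rw [show 2 * T - zetaOrdinate n = -(zetaOrdinate n - 2 * T) by ring, Real.arctan_neg,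
      show T - zetaOrdinate n = -(zetaOrdinate n - T) by ring, Real.arctan_neg]
    have h1 : Real.arctan (zetaOrdinate n - T) ≤ Real.arctan (zetaOrdinate n) :=
      Real.arctan_mono (by linarith)
    linarith
  have hB3 : ∑ n ∈ Finset.range (zetaZeroCount Z),
      (Real.arctan (2 * T + zetaOrdinate n) - Real.arctan (T + zetaOrdinate n)) ≤
      Bb * Real.log (2 * T + 2) ^ 2 := by
    refine le_trans (Finset.sum_le_sum fun n _ ↦ ?_) (hBb (2 * T) (by linarith) _)
    have h1 : Real.arctan (zetaOrdinate n) ≤ Real.arctan (T + zetaOrdinate n) :=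
      Real.arctan_mono (by linarith)
    linarith
  -- assemble
  have hlog : Real.log (T + 2) ^ 2 ≤ Real.log (2 * T + 2) ^ 2 := by
    have h1 : 0 ≤ Real.log (T + 2) := Real.log_nonneg (by linarith)
    have h2 : Real.log (T + 2) ≤ Real.log (2 * T + 2) := Real.log_le_log (by linarith) (by linarith)
    nlinarith
  have hBc0 : 0 ≤ Bc := by
    have h := hBc 2 le_rfl ∅ (by simp)
    simp only [Finset.sum_empty] at h
    have : 0 < Real.log (2 + 2) ^ 2 := by
      have : 0 < Real.log (2 + 2) := Real.log_pos (by norm_num)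
      positivity
    nlinarith [h]
  simp_rw [hsplit]
  rw [intervalIntegral.integral_add (hS1.add hS2) hS3, intervalIntegral.integral_add hS1 hS2, hI1, hI2, hI3]
  nlinarith [mul_le_mul_of_nonneg_left hlog hBc0]

/-! ## §6. The zero side is continuous in `t` -/

/-- `S_u(x,·)` is continuous on every compact interval (`x ≥ 1`): the series converges uniformly
there (`‖m(ρ)x^{ρ−1/2}K(ρ−½,t)‖ ≤ 8x^{1/2}(1+M²)·m(ρ)/(1+γ²)` for `|t| ≤ M`).
[cite: BaluyotEtAl2024, §2 (trivialestimate)] -/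
theorem continuousOn_zeroKernelSeries {x : ℝ} (hx : 1 ≤ x) (a b : ℝ) :
    ContinuousOn (fun t : ℝ ↦ zeroKernelSeries x t) (Icc a b) := by
  set M : ℝ := max |a| |b| with hM
  have hS : Summable fun ρ : ZetaZeros.riemannZetaNontrivialZeros ↦
      (riemannZetaZeroOrder (ρ : ℂ) : ℝ) / (1 + (ρ : ℂ).im ^ 2) :=
    ZetaZeroSum.summable_zeroOrder_div_one_add_sq
  unfold zeroKernelSeries
  refine continuousOn_tsum (u := fun ρ : ZetaZeros.riemannZetaNontrivialZeros ↦
      8 * x ^ (1 / 2 : ℝ) * (1 + M ^ 2) * ((riemannZetaZeroOrder (ρ : ℂ) : ℝ) / (1 + (ρ : ℂ).im ^ 2)))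
    (fun ρ ↦ ?_) (hS.mul_left _) fun ρ t ht ↦ ?_
  · refine Continuous.continuousOn ?_
    unfold zeroKernelTerm
    exact continuous_const.mul (continuous_kernel ((abs_re_sub_half_lt ρ.2).trans (by norm_num)))
  · have h := norm_zeroKernelTerm_le hx t ρ.2
    rw [mult_eq_order ρ.2] at h
    refine h.trans ?_
    have htM : t ^ 2 ≤ M ^ 2 := by
      have h1 : |t| ≤ M := by
        rw [hM, abs_le]
        constructor
        · have := neg_abs_le a; have := le_max_left |a| |b|; linarith [ht.1]
        · exact (le_abs_self b).trans (le_max_right _ _) |>.trans' ht.2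
      have h0 : 0 ≤ |t| := abs_nonneg t
      nlinarith [sq_abs t]
    have hm : 0 ≤ (riemannZetaZeroOrder (ρ : ℂ) : ℝ) / (1 + (ρ : ℂ).im ^ 2) := by
      have : (0 : ℝ) ≤ riemannZetaZeroOrder (ρ : ℂ) := by
        rw [← mult_eq_order ρ.2]; exact Nat.cast_nonneg _
      positivity
    have hx12 : 0 ≤ x ^ (1 / 2 : ℝ) := by positivity
    have : 8 * x ^ (1 / 2 : ℝ) * (1 + t ^ 2) ≤ 8 * x ^ (1 / 2 : ℝ) * (1 + M ^ 2) := by nlinarith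
    exact mul_le_mul_of_nonneg_right this hm

/-! ## §7. The window sum off the window (Part A): `∫_{ℝ∖[T,2T]} ‖S₁‖² ≪ x^{2θ−1} log³T` -/

/-- Powers: `(x^{θ−1/2})² = x^{2θ−1}`. [folklore] -/
private theorem rpow_sub_half_sq {x : ℝ} (hx : 0 < x) (θ : ℝ) :
    (x ^ (θ - 1 / 2)) ^ 2 = x ^ (2 * θ - 1) := by
  rw [sq, ← Real.rpow_add hx]; congr 1; ring

/-- **Part A.** Off the window the mean square of `S₁` is small: for `T ≥ 2`, `x ≥ 1` and
`Re ρ ≤ θ` on the window, `0 ≤ ∫_ℝ ‖S₁‖² − ∫_T^{2T} ‖S₁‖² ≤ C_A x^{2θ−1} log³(2T+2)` with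
`C_A = 256C₀B_d + 384C₀B_a + 128C₀B_c` — by `‖S₁‖² ≤ 16x^{2θ−1} D_W²`, the sup bounds of §4 and the
`L¹` bounds (Za), (Zc), (Zd) of §5 (Montgomery: "extend the integration to `ℝ` with a small error").
[cite: BaluyotEtAl2024, Lemma 4 (proof: «the range of integration can be extended to ℝ»)] -/
theorem integral_compl_window_le {C₀ Ba Bc Bd : ℝ} (hC₀ : 0 ≤ C₀)
    (hW : ∀ u : ℝ, (zetaZeroCount (u + 1) : ℝ) - zetaZeroCount u ≤ C₀ * Real.log (|u| + 2))
    (hBa : ∀ T : ℝ, 2 ≤ T → ∀ s : Finset ℕ, (∀ n ∈ s, T < zetaOrdinate n) →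
      ∑ n ∈ s, (Real.arctan (zetaOrdinate n) - Real.arctan (zetaOrdinate n - T)) ≤
        Ba * Real.log (T + 2) ^ 2)
    (hBc : ∀ T : ℝ, 2 ≤ T → ∀ s : Finset ℕ, (∀ n ∈ s, zetaOrdinate n ≤ T) →
      ∑ n ∈ s, (π / 2 - Real.arctan (T - zetaOrdinate n)) ≤ Bc * Real.log (T + 2) ^ 2)
    (hBd : ∀ T : ℝ, 2 ≤ T → ∀ s : Finset ℕ, (∀ n ∈ s, zetaOrdinate n ≤ T) →
      ∑ n ∈ s, (π / 2 - Real.arctan (zetaOrdinate n)) ≤ Bd * Real.log (T + 2) ^ 2)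
    {x : ℝ} (hx : 1 ≤ x) {T θ : ℝ} (hT : 2 ≤ T) (hθ : ∀ ρ ∈ zerosIn T, ρ.re ≤ θ) :
    0 ≤ (∫ t : ℝ, ‖zeroKernelSum (zerosIn T) x t‖ ^ 2) -
        ∫ t in T..(2 * T), ‖zeroKernelSum (zerosIn T) x t‖ ^ 2 ∧
      (∫ t : ℝ, ‖zeroKernelSum (zerosIn T) x t‖ ^ 2) -
          ∫ t in T..(2 * T), ‖zeroKernelSum (zerosIn T) x t‖ ^ 2 ≤
        (256 * C₀ * Bd + 384 * C₀ * Ba + 128 * C₀ * Bc) * x ^ (2 * θ - 1) * Real.log (2 * T + 2) ^ 3 := by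
  have hx0 : 0 < x := one_pos.trans_le hx
  have hT0 : 0 ≤ T := by linarith
  set L : ℝ := Real.log (2 * T + 2) with hL
  have hL1 : 1 ≤ L := by
    rw [hL, ← Real.log_exp 1]
    exact Real.log_le_log (Real.exp_pos 1) (by linarith [Real.exp_one_lt_d9])
  have hL0 : 0 ≤ L := by linarith
  set f : ℝ → ℝ := fun t ↦ ‖zeroKernelSum (zerosIn T) x t‖ ^ 2 with hf
  set D : ℝ → ℝ := fun t ↦ windowDensity T t with hD
  have hfi : Integrable f :=
    integrable_norm_zeroKernelSum_sq (zerosIn T) (fun ρ hρ ↦ mem_nontrivialZeros_of_mem_zerosIn hρ) x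
  have hDi : Integrable D := integrable_windowDensity T
  have hf0 : ∀ t, 0 ≤ f t := fun t ↦ by positivity
  -- pointwise: `f ≤ 16 x^{2θ−1} D²`
  set P : ℝ := x ^ (2 * θ - 1) with hP
  have hP0 : 0 ≤ P := by positivity
  have hpt : ∀ t : ℝ, f t ≤ 16 * P * D t ^ 2 := by
    intro t
    have h := norm_zeroKernelSum_zerosIn_le hx hθ t
    have h0 : 0 ≤ 4 * x ^ (θ - 1 / 2) * windowDensity T t := by
      have := windowDensity_nonneg T t; positivity
    calc f t = ‖zeroKernelSum (zerosIn T) x t‖ ^ 2 := rfl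
      _ ≤ (4 * x ^ (θ - 1 / 2) * windowDensity T t) ^ 2 := pow_le_pow_left₀ (norm_nonneg _) h 2
      _ = 16 * P * D t ^ 2 := by rw [hP, ← rpow_sub_half_sq hx0]; ring
  -- decomposition `∫ f − ∫_T^{2T} f = ∫_{Iic 0} f + ∫_0^T f + ∫_{Ioi 2T} f`
  have hdec : (∫ t : ℝ, f t) - ∫ t in T..(2 * T), f t =
      (∫ t in Iic (0 : ℝ), f t) + (∫ t in (0 : ℝ)..T, f t) + ∫ t in Ioi (2 * T), f t := by
    have h1 := (integral_Iic_add_Ioi hfi.integrableOn hfi.integrableOn (b := 0)).symm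
    have h2 := (integral_interval_add_Ioi (hfi.integrableOn (s := Ioi 0)) (hfi.integrableOn (s := Ioi T))
      (a := 0) (b := T) (μ := volume) (f := f)).symm
    have h3 := (integral_interval_add_Ioi (hfi.integrableOn (s := Ioi T))
      (hfi.integrableOn (s := Ioi (2 * T))) (a := T) (b := 2 * T) (μ := volume) (f := f)).symm
    rw [h1, h2, h3]
    ring
  -- the three pieces are non-negative
  have hA0 : 0 ≤ ∫ t in Iic (0 : ℝ), f t := setIntegral_nonneg measurableSet_Iic fun t _ ↦ hf0 t
  have hB0 : 0 ≤ ∫ t in (0 : ℝ)..T, f t := intervalIntegral.integral_nonneg hT0 fun t _ ↦ hf0 t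
  have hC0' : 0 ≤ ∫ t in Ioi (2 * T), f t := setIntegral_nonneg measurableSet_Ioi fun t _ ↦ hf0 t
  refine ⟨by rw [hdec]; positivity, ?_⟩
  -- piece 1: `t ≤ 0`, `D ≤ 16 C₀`
  have hA : ∫ t in Iic (0 : ℝ), f t ≤ 256 * C₀ * Bd * P * L ^ 2 := by
    have hmono : ∫ t in Iic (0 : ℝ), f t ≤ ∫ t in Iic (0 : ℝ), (16 * P * (16 * C₀)) * D t := by
      refine setIntegral_mono_on hfi.integrableOn ((hDi.const_mul _).integrableOn) measurableSet_Iic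
        fun t ht ↦ (hpt t).trans ?_
      have hD0 : 0 ≤ D t := windowDensity_nonneg T t
      have hDle : D t ≤ 16 * C₀ := windowDensity_le_of_nonpos hC₀ hW ht
      rw [sq]
      have : D t * D t ≤ 16 * C₀ * D t := mul_le_mul_of_nonneg_right hDle hD0
      nlinarith
    rw [MeasureTheory.integral_const_mul] at hmono
    have hI := integral_Iic_windowDensity_le hBd (T := T) (by linarith)
    calc ∫ t in Iic (0 : ℝ), f t ≤ 16 * P * (16 * C₀) * ∫ t in Iic (0 : ℝ), D t := hmono
      _ ≤ 16 * P * (16 * C₀) * (Bd * L ^ 2) := mul_le_mul_of_nonneg_left hI (by positivity)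
      _ = 256 * C₀ * Bd * P * L ^ 2 := by ring
  -- piece 2: `0 ≤ t ≤ T`, `D ≤ 24 C₀ L`
  have hB : ∫ t in (0 : ℝ)..T, f t ≤ 384 * C₀ * Ba * P * L ^ 3 := by
    have hmono : ∫ t in (0 : ℝ)..T, f t ≤ ∫ t in (0 : ℝ)..T, (16 * P * (24 * C₀ * L)) * D t := by
      refine intervalIntegral.integral_mono_on hT0 hfi.intervalIntegrable
        ((hDi.const_mul _).intervalIntegrable) fun t ht ↦ (hpt t).trans ?_
      have hD0 : 0 ≤ D t := windowDensity_nonneg T t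
      have hDle : D t ≤ 24 * C₀ * L := windowDensity_le_of_mem_Icc hC₀ hW ht.1 (by linarith [ht.2])
      rw [sq]
      have : D t * D t ≤ 24 * C₀ * L * D t := mul_le_mul_of_nonneg_right hDle hD0
      nlinarith
    rw [intervalIntegral.integral_const_mul] at hmono
    have hI := integral_zero_T_windowDensity_le hBa hT
    have hlogT : Real.log (T + 2) ^ 2 ≤ L ^ 2 := by
      have h1 : 0 ≤ Real.log (T + 2) := Real.log_nonneg (by linarith)
      have h2 : Real.log (T + 2) ≤ L := Real.log_le_log (by linarith) (by linarith)
      nlinarith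
    have hBa0 : 0 ≤ Ba := by
      have h := hBa 2 le_rfl ∅ (by simp)
      simp only [Finset.sum_empty] at h
      have : 0 < Real.log (2 + 2) ^ 2 := by
        have : 0 < Real.log (2 + 2) := Real.log_pos (by norm_num)
        positivity
      nlinarith [h]
    calc ∫ t in (0 : ℝ)..T, f t ≤ 16 * P * (24 * C₀ * L) * ∫ t in (0 : ℝ)..T, D t := hmono
      _ ≤ 16 * P * (24 * C₀ * L) * (Ba * L ^ 2) :=
          mul_le_mul_of_nonneg_left (hI.trans (mul_le_mul_of_nonneg_left hlogT hBa0)) (by positivity)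
      _ = 384 * C₀ * Ba * P * L ^ 3 := by ring
  -- piece 3: `t ≥ 2T`, `D ≤ 8 C₀ L`
  have hC : ∫ t in Ioi (2 * T), f t ≤ 128 * C₀ * Bc * P * L ^ 3 := by
    have hmono : ∫ t in Ioi (2 * T), f t ≤ ∫ t in Ioi (2 * T), (16 * P * (8 * C₀ * L)) * D t := by
      refine setIntegral_mono_on hfi.integrableOn ((hDi.const_mul _).integrableOn) measurableSet_Ioi
        fun t ht ↦ (hpt t).trans ?_
      have hD0 : 0 ≤ D t := windowDensity_nonneg T t
      have ht' : 2 * T ≤ t := le_of_lt ht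
      have hDle : D t ≤ 8 * C₀ * L := by
        refine (windowDensity_le_of_le hC₀ hW hT0 ht').trans ?_
        exact div_le_self (by positivity) (by linarith)
      rw [sq]
      have : D t * D t ≤ 8 * C₀ * L * D t := mul_le_mul_of_nonneg_right hDle hD0
      nlinarith
    rw [MeasureTheory.integral_const_mul] at hmono
    have hI := integral_Ioi_windowDensity_le hBc (T := T) (by linarith)
    calc ∫ t in Ioi (2 * T), f t ≤ 16 * P * (8 * C₀ * L) * ∫ t in Ioi (2 * T), D t := hmono
      _ ≤ 16 * P * (8 * C₀ * L) * (Bc * L ^ 2) := mul_le_mul_of_nonneg_left hI (by positivity)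
      _ = 128 * C₀ * Bc * P * L ^ 3 := by ring
  have hBd0 : 0 ≤ 256 * C₀ * Bd * P * L ^ 2 := le_trans hA0 hA
  rw [hdec]
  have hL23 : L ^ 2 ≤ L ^ 3 := by nlinarith
  have : 256 * C₀ * Bd * P * L ^ 2 ≤ 256 * C₀ * Bd * P * L ^ 3 := by
    have hL2 : 0 < L ^ 2 := by positivity
    have hc : 0 ≤ 256 * C₀ * Bd * P :=
      le_of_mul_le_mul_right (by rw [zero_mul]; exact hBd0) hL2
    exact mul_le_mul_of_nonneg_left hL23 hc
  linarith

/-! ## §8. The mean square of the zero side on the window (Part B) and the main estimate -/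

/-- `|a² − b²| ≤ d(d + 2b)` when `|a − b| ≤ d` and `a, b ≥ 0`. [folklore] -/
private theorem abs_sq_sub_sq_le {a b d : ℝ} (ha : 0 ≤ a) (hb : 0 ≤ b) (h : |a - b| ≤ d) :
    |a ^ 2 - b ^ 2| ≤ d * (d + 2 * b) := by
  have hd : 0 ≤ d := (abs_nonneg _).trans h
  have hab : a ≤ b + d := by linarith [(abs_le.1 h).2]
  rw [show a ^ 2 - b ^ 2 = (a - b) * (a + b) by ring, abs_mul, abs_of_nonneg (by linarith : 0 ≤ a + b)]
  calc |a - b| * (a + b) ≤ d * (a + b) := mul_le_mul_of_nonneg_right h (by linarith)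
    _ ≤ d * (d + 2 * b) := mul_le_mul_of_nonneg_left (by linarith) hd

/-- **BGST 2024, Lemma 4, for the dyadic window — the zero side of (MT).** There is an absolute `C`
such that for all `T ≥ 4`, `x ≥ 1` and `θ ≤ 1` with `Re ρ ≤ θ` for every non-trivial zero `ρ` with
`|Im ρ| ≤ T²`:
`|∫_T^{2T} ‖S_u(x,t)‖² dt − (π/2) Re 𝓕(x,T)| ≤ C (x^{2θ−1} log³(2T+2) + x log²(2T+2)/T)`,
where `S_u(x,t) = Σ_ρ m(ρ) x^{ρ−1/2}/(1−(ρ−1/2−it)²)` (all zeros, `BGSTB2024.zeroKernelSeries`) and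
`(π/2) Re 𝓕(x,T) = ∫_ℝ ‖S₁‖²` is the dyadic pair sum by Lemma 3. In the source: "`L(x,T) = 2πF(x,T)
+ O(x^{1−2η(T log²T)} log³T) + O(x)`" with `L = 4x∫|S_u|²` over `[0,T]` and `Θ(Z) ≤ 1 − η(Z)`; here
the window is `(T,2T]`, `Z = T²`, the bound `Θ(Z) ≤ θ` is the hypothesis, and the truncation error is
`O(x log²T/T)`. Part B (on the window): `|‖S_u‖² − ‖S₁‖²| ≤ ‖S_u−S₁‖(‖S_u−S₁‖ + 2‖S₁‖)` with
`norm_zeroKernelSeries_sub_le`, `norm_zeroKernelSum_zerosIn_le` and the bounds of §§4–5; Part A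
(off the window): `integral_compl_window_le`.
[cite: BaluyotEtAl2024, Lemma 4] -/
theorem dyadic_zeroSide : ∃ C : ℝ, 0 < C ∧ ∀ T : ℝ, 4 ≤ T → ∀ x : ℝ, 1 ≤ x → ∀ θ : ℝ, θ ≤ 1 →
    (∀ ρ ∈ ZetaZeros.riemannZetaNontrivialZeros, |ρ.im| ≤ T ^ 2 → ρ.re ≤ θ) →
      |(∫ t in T..(2 * T), ‖zeroKernelSeries x t‖ ^ 2) - π / 2 * (pairSumDyadic x T).re| ≤
        C * (x ^ (2 * θ - 1) * Real.log (2 * T + 2) ^ 3 + x * Real.log (2 * T + 2) ^ 2 / T) := by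
  obtain ⟨C₀, hC₀pos, hW⟩ := exists_zetaZeroCount_window_le
  have hC₀ : 0 ≤ C₀ := hC₀pos.le
  obtain ⟨Ba, hBa0, hBa⟩ := exists_sum_arctan_sub_arctan_sub_le
  obtain ⟨Bb, hBb0, hBb⟩ := exists_sum_arctan_add_sub_arctan_le
  obtain ⟨Bc, hBc0, hBc⟩ := exists_sum_pi_div_two_sub_arctan_sub_le
  obtain ⟨Bd, hBd0, hBd⟩ := exists_sum_pi_div_two_sub_arctan_le
  refine ⟨(256 * C₀ * Bd + 384 * C₀ * Ba + 128 * C₀ * Bc) + 32 * (104 * C₀) * (Ba + Bb + Bc) +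
    32 * 128 * 152 * C₀ ^ 2 + 1, by positivity, fun T hT x hx θ hθ1 hθ ↦ ?_⟩
  have hCA0 : 0 ≤ 256 * C₀ * Bd + 384 * C₀ * Ba + 128 * C₀ * Bc := by positivity
  have hCB0 : 0 ≤ 32 * (104 * C₀) * (Ba + Bb + Bc) := by positivity
  have hCF0 : 0 ≤ 32 * 128 * 152 * C₀ ^ 2 := by positivity
  have hBsum0 : 0 ≤ Ba + Bb + Bc := by positivity
  -- basic quantities
  have hx0 : 0 < x := one_pos.trans_le hx
  have hT2 : 2 ≤ T := by linarith
  have hT0 : 0 ≤ T := by linarith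
  have hT1 : 1 ≤ T := by linarith
  have hTT : T ≤ 2 * T := by linarith
  have hTpos : 0 < T := by linarith
  -- the truncation height `Z = T²`
  set Z : ℝ := T ^ 2 with hZ
  have hTZ : 2 * T ≤ Z := by rw [hZ]; nlinarith
  have hZT : T ^ 2 / 2 ≤ Z - 2 * T + 1 := by rw [hZ]; nlinarith
  have hZT0 : 0 < Z - 2 * T + 1 := by
    have : 0 < T ^ 2 / 2 := by positivity
    linarith
  have hZle : Z + 2 ≤ (2 * T + 2) ^ 2 := by rw [hZ]; nlinarith
  clear_value Z
  -- the logarithms `L = log(2T+2) ≥ 1` and `LZ = log(Z+2) ≤ 2L`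
  set L : ℝ := Real.log (2 * T + 2) with hL
  have hL1 : 1 ≤ L := by
    rw [hL, ← Real.log_exp 1]
    exact Real.log_le_log (Real.exp_pos 1) (by linarith [Real.exp_one_lt_d9])
  have hL0 : 0 ≤ L := by linarith
  set LZ : ℝ := Real.log (Z + 2) with hLZ
  have hLZ0 : 0 ≤ LZ := by rw [hLZ]; exact Real.log_nonneg (by linarith)
  have hLZle : LZ ≤ 2 * L := by
    have e : Real.log ((2 * T + 2) ^ 2) = 2 * L := by
      rw [Real.log_pow, hL]; push_cast; ring
    rw [hLZ, ← e]
    exact Real.log_le_log (by linarith) hZle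
  clear_value L LZ
  -- `μ = x^{θ−1} ≤ 1`
  set μ : ℝ := x ^ (θ - 1) with hμ
  have hμ0 : 0 ≤ μ := by rw [hμ]; exact Real.rpow_nonneg hx0.le _
  have hμ1 : μ ≤ 1 := by rw [hμ]; exact Real.rpow_le_one_of_one_le_of_nonpos hx (by linarith)
  have hxhalf : x ^ (θ - 1 / 2) = x ^ (1 / 2 : ℝ) * μ := by
    rw [hμ, ← Real.rpow_add hx0]; congr 1; ring
  have hxsq : x ^ (1 / 2 : ℝ) * x ^ (1 / 2 : ℝ) = x := by
    rw [← Real.rpow_add hx0]; norm_num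
  have hx12 : 0 ≤ x ^ (1 / 2 : ℝ) := Real.rpow_nonneg hx0.le _
  have hxμ : x ^ (2 * θ - 1) = x * μ ^ 2 := by
    rw [show 2 * θ - 1 = 1 + (θ - 1) + (θ - 1) by ring, Real.rpow_add hx0, Real.rpow_add hx0,
      Real.rpow_one, hμ]
    ring
  have hP0 : 0 ≤ x ^ (2 * θ - 1) := Real.rpow_nonneg hx0.le _
  clear_value μ
  -- the window hypothesis
  have hθW : ∀ ρ ∈ zerosIn T, ρ.re ≤ θ := by
    intro ρ hρ
    refine hθ ρ (mem_nontrivialZeros_of_mem_zerosIn hρ) ?_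
    rw [mem_zerosIn] at hρ
    have h1 := hρ.1.2.2.2
    rw [abs_of_pos h1.1]
    linarith [h1.2]
  -- constants on `[T, 2T]`: `D₁` (sup of `D_W`), `N₁` (sup of the near density), `Φ` (sup of the far one)
  set D₁ : ℝ := 24 * C₀ * L with hD₁
  set N₁ : ℝ := 40 * C₀ * LZ with hN₁
  set Φ : ℝ := 32 * C₀ * LZ / (Z - 2 * T + 1) with hΦ
  have h32 : 0 ≤ 32 * C₀ * LZ := mul_nonneg (mul_nonneg (by norm_num) hC₀) hLZ0
  have h128 : 0 ≤ 128 * C₀ * L := mul_nonneg (mul_nonneg (by norm_num) hC₀) hL0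
  have hD₁0 : 0 ≤ D₁ := by rw [hD₁]; exact mul_nonneg (mul_nonneg (by norm_num) hC₀) hL0
  have hN₁0 : 0 ≤ N₁ := by rw [hN₁]; exact mul_nonneg (mul_nonneg (by norm_num) hC₀) hLZ0
  have hΦ0 : 0 ≤ Φ := by rw [hΦ]; exact div_nonneg h32 hZT0.le
  have hND : N₁ + D₁ ≤ 104 * C₀ * L := by
    rw [hN₁, hD₁]
    have := mul_le_mul_of_nonneg_left hLZle (mul_nonneg (by norm_num : (0 : ℝ) ≤ 40) hC₀)
    linarith
  set Φm : ℝ := 128 * C₀ * L / T ^ 2 with hΦm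
  have hΦle : Φ ≤ Φm := by
    rw [hΦ, hΦm, div_le_div_iff₀ hZT0 (pow_pos hTpos 2)]
    calc 32 * C₀ * LZ * T ^ 2 ≤ 64 * C₀ * L * T ^ 2 := by
          have : 32 * C₀ * LZ ≤ 64 * C₀ * L := by
            have := mul_le_mul_of_nonneg_left hLZle (mul_nonneg (by norm_num : (0 : ℝ) ≤ 32) hC₀)
            linarith
          exact mul_le_mul_of_nonneg_right this (pow_nonneg hT0 2)
      _ = 128 * C₀ * L * (T ^ 2 / 2) := by ring
      _ ≤ 128 * C₀ * L * (Z - 2 * T + 1) := mul_le_mul_of_nonneg_left hZT h128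
  have hΦm0 : 0 ≤ Φm := by rw [hΦm]; exact div_nonneg h128 (pow_nonneg hT0 2)
  have hΦmle : Φm ≤ 128 * C₀ * L := by
    rw [hΦm]
    exact div_le_self h128 (one_le_pow₀ hT1)
  have hΦmT : Φm * T = 128 * C₀ * L / T := by
    rw [hΦm, div_mul_eq_mul_div, pow_two, mul_div_mul_right _ _ hTpos.ne']
  clear_value D₁ N₁ Φ Φm
  -- pointwise bounds on the window
  have hNear0 : ∀ t, 0 ≤ truncDensity Z t - windowDensity T t :=
    fun t ↦ sub_nonneg.2 (windowDensity_le_truncDensity hTZ t)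
  have hNearle : ∀ t ∈ Icc T (2 * T), truncDensity Z t - windowDensity T t ≤ N₁ := by
    intro t ht
    have h1 := truncDensity_le hC₀ hW (Z := Z) (t := t) (by linarith [ht.1]) (by linarith [ht.2])
    rw [← hLZ] at h1
    have h2 := windowDensity_nonneg T t
    rw [hN₁]
    linarith
  have hS₁le : ∀ t ∈ Icc T (2 * T),
      ‖zeroKernelSum (zerosIn T) x t‖ ≤ 4 * x ^ (1 / 2 : ℝ) * μ * D₁ := by
    intro t ht
    have h := norm_zeroKernelSum_zerosIn_le hx hθW t
    have hD := windowDensity_le_of_mem_Icc hC₀ hW (T := T) (t := t) (by linarith [ht.1]) ht.2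
    rw [← hL] at hD
    rw [hxhalf] at h
    refine h.trans ?_
    rw [hD₁]
    have : 0 ≤ 4 * (x ^ (1 / 2 : ℝ) * μ) := mul_nonneg (by norm_num) (mul_nonneg hx12 hμ0)
    calc 4 * (x ^ (1 / 2 : ℝ) * μ) * windowDensity T t
        ≤ 4 * (x ^ (1 / 2 : ℝ) * μ) * (24 * C₀ * L) := mul_le_mul_of_nonneg_left hD this
      _ = 4 * x ^ (1 / 2 : ℝ) * μ * (24 * C₀ * L) := by ring
  have hdle : ∀ t ∈ Icc T (2 * T), ‖zeroKernelSeries x t - zeroKernelSum (zerosIn T) x t‖ ≤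
      4 * x ^ (1 / 2 : ℝ) * (μ * (truncDensity Z t - windowDensity T t) + Φ) := by
    intro t ht
    have h := norm_zeroKernelSeries_sub_le hx hT0 hTZ hθ t
    rw [← hμ] at h
    have hF0 := farDensity_le hC₀ hW (Z := Z) (t := t) (by linarith [ht.1]) (by linarith [ht.2])
    rw [← hLZ] at hF0
    have hF : farDensity Z t ≤ Φ := by
      refine hF0.trans ?_
      rw [hΦ]
      exact div_le_div_of_nonneg_left h32 hZT0 (by linarith [ht.2])
    refine h.trans (mul_le_mul_of_nonneg_left (by linarith) (mul_nonneg (by norm_num) hx12))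
  -- the majorant `K₁ · Near + K₂` on the window
  set K₁ : ℝ := 32 * x * μ ^ 2 * (N₁ + D₁) with hK₁
  set K₂ : ℝ := 32 * x * (Φ ^ 2 + μ * D₁ * Φ) with hK₂
  have hK₁0 : 0 ≤ K₁ := by
    rw [hK₁]
    exact mul_nonneg (mul_nonneg (mul_nonneg (by norm_num) hx0.le) (sq_nonneg μ)) (add_nonneg hN₁0 hD₁0)
  have hK₂0 : 0 ≤ K₂ := by
    rw [hK₂]
    exact mul_nonneg (mul_nonneg (by norm_num) hx0.le)
      (add_nonneg (sq_nonneg Φ) (mul_nonneg (mul_nonneg hμ0 hD₁0) hΦ0))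
  clear_value K₁ K₂
  have hG : ∀ t ∈ Icc T (2 * T),
      |‖zeroKernelSeries x t‖ ^ 2 - ‖zeroKernelSum (zerosIn T) x t‖ ^ 2| ≤
        K₁ * (truncDensity Z t - windowDensity T t) + K₂ := by
    intro t ht
    have h1 := abs_sq_sub_sq_le (norm_nonneg (zeroKernelSeries x t))
      (norm_nonneg (zeroKernelSum (zerosIn T) x t)) ((abs_norm_sub_norm_le _ _).trans (hdle t ht))
    refine h1.trans ?_
    have hb := hS₁le t ht
    have hN := hNearle t ht
    have hN0 := hNear0 t
    obtain ⟨Nr, hNr⟩ : ∃ Nr : ℝ, truncDensity Z t - windowDensity T t = Nr := ⟨_, rfl⟩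
    rw [hNr] at h1 hN hN0 ⊢
    obtain ⟨E, hE⟩ : ∃ E : ℝ, μ * Nr + Φ = E := ⟨_, rfl⟩
    rw [hE]
    have hE0 : 0 ≤ E := by rw [← hE]; exact add_nonneg (mul_nonneg hμ0 hN0) hΦ0
    have hδ0 : 0 ≤ 4 * x ^ (1 / 2 : ℝ) * E := mul_nonneg (mul_nonneg (by norm_num) hx12) hE0
    have hE2 : E ^ 2 ≤ 2 * μ ^ 2 * (N₁ * Nr) + 2 * Φ ^ 2 := by
      have h1 : E ^ 2 ≤ 2 * (μ * Nr) ^ 2 + 2 * Φ ^ 2 := by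
        rw [← hE]
        have e : (μ * Nr + Φ) ^ 2 = 2 * (μ * Nr) ^ 2 + 2 * Φ ^ 2 - (μ * Nr - Φ) ^ 2 := by ring
        rw [e]
        linarith [sq_nonneg (μ * Nr - Φ)]
      have h2 : (μ * Nr) ^ 2 ≤ μ ^ 2 * (N₁ * Nr) := by
        rw [mul_pow, sq Nr]
        exact mul_le_mul_of_nonneg_left (mul_le_mul_of_nonneg_right hN hN0) (sq_nonneg μ)
      linarith
    have h16 : 0 ≤ 16 * x := mul_nonneg (by norm_num) hx0.le
    calc 4 * x ^ (1 / 2 : ℝ) * E * (4 * x ^ (1 / 2 : ℝ) * E + 2 * ‖zeroKernelSum (zerosIn T) x t‖)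
        ≤ 4 * x ^ (1 / 2 : ℝ) * E * (4 * x ^ (1 / 2 : ℝ) * E + 2 * (4 * x ^ (1 / 2 : ℝ) * μ * D₁)) :=
          mul_le_mul_of_nonneg_left (by linarith) hδ0
      _ = 16 * (x ^ (1 / 2 : ℝ) * x ^ (1 / 2 : ℝ)) * (E ^ 2 + 2 * μ * D₁ * E) := by ring
      _ = 16 * x * E ^ 2 + 16 * x * (2 * μ * D₁ * E) := by rw [hxsq]; ring
      _ ≤ 16 * x * (2 * μ ^ 2 * (N₁ * Nr) + 2 * Φ ^ 2) + 16 * x * (2 * μ * D₁ * E) := by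
          have := mul_le_mul_of_nonneg_left hE2 h16
          linarith
      _ = K₁ * Nr + K₂ := by rw [hK₁, hK₂, ← hE]; ring
  -- integrability on the window
  have hZnt : ∀ ρ ∈ zerosIn T, ρ ∈ ZetaZeros.riemannZetaNontrivialZeros :=
    fun ρ hρ ↦ mem_nontrivialZeros_of_mem_zerosIn hρ
  have hSint : IntervalIntegrable (fun t ↦ ‖zeroKernelSeries x t‖ ^ 2) volume T (2 * T) := by
    refine ContinuousOn.intervalIntegrable ?_
    rw [uIcc_of_le hTT]
    exact ((continuousOn_zeroKernelSeries hx T (2 * T)).norm).pow 2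
  have hS₁int : IntervalIntegrable (fun t ↦ ‖zeroKernelSum (zerosIn T) x t‖ ^ 2) volume T (2 * T) :=
    (((continuous_zeroKernelSum _ hZnt x).norm).pow 2).intervalIntegrable _ _
  have hNc : Continuous fun t ↦ truncDensity Z t - windowDensity T t :=
    (continuous_truncDensity Z).sub (continuous_windowDensity T)
  have hGint : IntervalIntegrable (fun t ↦ K₁ * (truncDensity Z t - windowDensity T t) + K₂)
      volume T (2 * T) :=
    ((continuous_const.mul hNc).add continuous_const).intervalIntegrable _ _
  -- Part B: on the window
  have hnear := integral_near_le hBa hBb hBc hT2 hTZ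
  rw [← hL] at hnear
  have hIG : ∫ t in T..(2 * T), (K₁ * (truncDensity Z t - windowDensity T t) + K₂) =
      K₁ * (∫ t in T..(2 * T), (truncDensity Z t - windowDensity T t)) + K₂ * T := by
    have hI1 : IntervalIntegrable (fun t ↦ K₁ * (truncDensity Z t - windowDensity T t)) volume T (2 * T) :=
      (continuous_const.mul hNc).intervalIntegrable _ _
    have hI2 : IntervalIntegrable (fun _ ↦ K₂) volume T (2 * T) := continuous_const.intervalIntegrable _ _
    rw [intervalIntegral.integral_add hI1 hI2, intervalIntegral.integral_const_mul,
      intervalIntegral.integral_const, smul_eq_mul]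
    ring
  have hPartB : |(∫ t in T..(2 * T), ‖zeroKernelSeries x t‖ ^ 2) -
      ∫ t in T..(2 * T), ‖zeroKernelSum (zerosIn T) x t‖ ^ 2| ≤
      K₁ * ((Ba + Bb + Bc) * L ^ 2) + K₂ * T := by
    rw [← intervalIntegral.integral_sub hSint hS₁int]
    have h := intervalIntegral.norm_integral_le_of_norm_le hTT
      (f := fun t ↦ ‖zeroKernelSeries x t‖ ^ 2 - ‖zeroKernelSum (zerosIn T) x t‖ ^ 2)
      (g := fun t ↦ K₁ * (truncDensity Z t - windowDensity T t) + K₂) (μ := volume)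
      (ae_of_all _ fun t ht ↦ ?_) hGint
    · rw [Real.norm_eq_abs, hIG] at h
      refine h.trans ?_
      have := mul_le_mul_of_nonneg_left hnear hK₁0
      linarith
    · rw [Real.norm_eq_abs]
      exact hG t (Ioc_subset_Icc_self ht)
  -- Part A (off the window) and Lemma 3
  have hPartA := integral_compl_window_le hC₀ hW hBa hBc hBd hx hT2 hθW
  have hL3 := integral_norm_zeroKernelSum_zerosIn_sq hx0 T
  -- numerical bookkeeping
  have hK₁le : K₁ * ((Ba + Bb + Bc) * L ^ 2) ≤
      32 * (104 * C₀) * (Ba + Bb + Bc) * x ^ (2 * θ - 1) * L ^ 3 := by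
    have h1 : K₁ ≤ 32 * x ^ (2 * θ - 1) * (104 * C₀ * L) := by
      rw [hK₁, hxμ]
      have h0 : 0 ≤ 32 * x * μ ^ 2 := mul_nonneg (mul_nonneg (by norm_num) hx0.le) (sq_nonneg μ)
      calc 32 * x * μ ^ 2 * (N₁ + D₁) ≤ 32 * x * μ ^ 2 * (104 * C₀ * L) :=
            mul_le_mul_of_nonneg_left hND h0
        _ = 32 * (x * μ ^ 2) * (104 * C₀ * L) := by ring
    have hB0 : 0 ≤ (Ba + Bb + Bc) * L ^ 2 := mul_nonneg hBsum0 (sq_nonneg L)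
    calc K₁ * ((Ba + Bb + Bc) * L ^ 2)
        ≤ 32 * x ^ (2 * θ - 1) * (104 * C₀ * L) * ((Ba + Bb + Bc) * L ^ 2) :=
          mul_le_mul_of_nonneg_right h1 hB0
      _ = 32 * (104 * C₀) * (Ba + Bb + Bc) * x ^ (2 * θ - 1) * L ^ 3 := by ring
  have hK₂le : K₂ * T ≤ 32 * 128 * 152 * C₀ ^ 2 * (x * L ^ 2 / T) := by
    have h1 : Φ ^ 2 + μ * D₁ * Φ ≤ Φm * (Φm + D₁) := by
      have ha : Φ ^ 2 ≤ Φm ^ 2 := pow_le_pow_left₀ hΦ0 hΦle 2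
      have hb : μ * D₁ * Φ ≤ D₁ * Φm := by
        calc μ * D₁ * Φ ≤ 1 * D₁ * Φ :=
              mul_le_mul_of_nonneg_right (mul_le_mul_of_nonneg_right hμ1 hD₁0) hΦ0
          _ ≤ D₁ * Φm := by rw [one_mul]; exact mul_le_mul_of_nonneg_left hΦle hD₁0
      calc Φ ^ 2 + μ * D₁ * Φ ≤ Φm ^ 2 + D₁ * Φm := add_le_add ha hb
        _ = Φm * (Φm + D₁) := by ring
    have h2 : Φm * (Φm + D₁) ≤ Φm * (152 * C₀ * L) := by
      refine mul_le_mul_of_nonneg_left ?_ hΦm0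
      rw [hD₁]; linarith
    have h12 := h1.trans h2
    have hxT : 0 ≤ 32 * x * T := mul_nonneg (mul_nonneg (by norm_num) hx0.le) hT0
    calc K₂ * T = 32 * x * T * (Φ ^ 2 + μ * D₁ * Φ) := by rw [hK₂]; ring
      _ ≤ 32 * x * T * (Φm * (152 * C₀ * L)) := mul_le_mul_of_nonneg_left h12 hxT
      _ = 32 * x * (Φm * T) * (152 * C₀ * L) := by ring
      _ = 32 * 128 * 152 * C₀ ^ 2 * (x * L ^ 2 / T) := by rw [hΦmT]; ring
  -- combine
  have hmain : |(∫ t in T..(2 * T), ‖zeroKernelSeries x t‖ ^ 2) - π / 2 * (pairSumDyadic x T).re| ≤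
      32 * (104 * C₀) * (Ba + Bb + Bc) * x ^ (2 * θ - 1) * L ^ 3 +
        32 * 128 * 152 * C₀ ^ 2 * (x * L ^ 2 / T) +
        (256 * C₀ * Bd + 384 * C₀ * Ba + 128 * C₀ * Bc) * x ^ (2 * θ - 1) * L ^ 3 := by
    have e : (∫ t in T..(2 * T), ‖zeroKernelSeries x t‖ ^ 2) - π / 2 * (pairSumDyadic x T).re =
        ((∫ t in T..(2 * T), ‖zeroKernelSeries x t‖ ^ 2) -
            ∫ t in T..(2 * T), ‖zeroKernelSum (zerosIn T) x t‖ ^ 2) -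
          ((∫ t : ℝ, ‖zeroKernelSum (zerosIn T) x t‖ ^ 2) -
            ∫ t in T..(2 * T), ‖zeroKernelSum (zerosIn T) x t‖ ^ 2) := by
      rw [← hL3]; ring
    have hA2 := hPartA.2
    rw [← hL] at hA2
    rw [e]
    refine (abs_sub _ _).trans ?_
    rw [abs_of_nonneg hPartA.1]
    linarith [hPartB, hA2, hK₁le, hK₂le]
  refine hmain.trans ?_
  have h1 : 0 ≤ x ^ (2 * θ - 1) * L ^ 3 := mul_nonneg hP0 (pow_nonneg hL0 3)
  have h2 : 0 ≤ x * L ^ 2 / T := div_nonneg (mul_nonneg hx0.le (sq_nonneg L)) hT0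
  linarith [mul_nonneg hCA0 h2, mul_nonneg hCB0 h2, mul_nonneg hCF0 h1]

end BGSTB2024

end Literature.NumberTheory.LFunctions

end
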